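import Literature.AlgebraicGeometry.Motives.HodgeThetaAnnihilatorRealBlocksTimesSymplectic
import Literature.AlgebraicGeometry.Motives.HodgeThetaSymplecticIdeal
import Literature.AlgebraicGeometry.Motives.HodgeThetaSubalgebraSymplecticRankFour
import Literature.AlgebraicGeometry.Motives.HodgeThetaSubalgebraPerfect
import Literature.AlgebraicGeometry.Motives.HodgeLieReductiveAnyWeight
import Literature.AlgebraicGeometry.Motives.HodgeLieWeightOneIdealPair
import HarnessLib

/-!
# Rational tensors on `V₁ ⊕ V₂` killed by `Θ` are killed by `0 ⊕ 𝔰𝔩(V₂)` and by `Θ₁ ⊕ 0` when `V₂` is the `H¹` of a NON-CM ELLIPTIC CURVE and there is no non-zero morphism of Hodge structures `V₂ → V₁` (Moonen–Zarhin 1999 Lemma (3.4) with (3.3) for `X₂ = E`: `Hg(X × E) = Hg(X) × Hg(E)` or `Hom(E, X) ≠ 0` — the Lie step, Goursat WITHOUT the size bound)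

Family `hodge`, layer `Literature/AlgebraicGeometry/Motives` (abstract polarizable `ℚ`-Hodge structures; no
geometry). Research context: cell `pub-hodge-ring2` (HONEST FRAMING: research route conditional on HC_CM; not a
corollary; Q11.4-sentence-2 already refuted in dim ≥ 3), Literature lane, programme R22 («`E × X` for a NON-CM
elliptic curve `E` and ANY `X` with `Hom(E, X) = 0`»). UNCONDITIONAL linear algebra; theorems only, no definition,
no named fact (D-0026); no step towards a summit statement. It is the third member of the family
`HodgeThetaAnnihilatorSemisimpleTimesAbelian` (R4: second factor CM), `HodgeThetaAnnihilatorRealBlocksTimesSymplectic`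
(R14: second factor rigid symplectic and LARGER than the first, graph excluded by a SIZE bound): here the second
factor is the smallest possible — `dim V₂ = 2`, `End_Hdg(V₂) = ℚ`, `𝔰𝔭(V₂) = 𝔰𝔩₂` — and the FIRST factor is
ARBITRARY, so the graph `Γ_φ` of Moonen–Zarhin's (3.1) has to be excluded by their Lemma (3.3) argument
(eigenvalues of `J_Y` on an `𝔰𝔩₂`-isotypic piece) under the hypothesis `Hom_Hdg(V₂, V₁) = 0`.

THE PRINTED RESULT. B. Moonen, Yu. G. Zarhin, *Hodge classes on abelian varieties of low dimension*, Math. Ann.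
**315** (1999) 711–733, §3 [corpus: paper:arxiv-math_9901113 p. 6 L60–L96, p. 7 L1–L8]. (3.1): «`hg(X₁ × X₂) ≅
𝔤₁ ⊕ 𝔤₂ ⊕ Γ_φ … where `Γ_φ ⊆ 𝔤₃ ⊕ 𝔤₃` is the graph of the automorphism `φ`», and `𝔤₃ ≠ 0` «if and only if for
some `m` and `n` the Hodge ring `B(X₁^m × X₂^n)` is not generated by the elements coming from `B(X₁^m)` and
`B(X₂^n)`». Lemma (3.3): «… If `λ` is an eigenvalue of `J₂` on `U_j^{dq}` then we find that both `i + λ` and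
`−i + λ` occur as eigenvalues of `J_Y` … this is possible only if `λ = 0` … The graph `Γ_φ ⊂ hg(X) × hg(Y)` is a
`ℚ`-Lie subalgebra such that `Γ_{φ,ℂ} ∋ J_{X×Y} = (J_X, J_Y)`. Therefore `hg(X × Y) = Γ_φ` and some multiple of
`φ` corresponds to an isogeny from `X` to `Y`.» **Lemma (3.4)**: «Let `X₁` and `X₂` be nonzero complex abelian
varieties. Write `X = X₁ × X₂`. Assume that `hg(X₂)` is a `ℚ`-simple Lie algebra of non-compact type and that, up
to isomorphism, `V_{X₂}` is the only irreducible `hg(X₂)`-module which is a length 1 representation of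
non-compact type. Then either `Hg(X) = Hg(X₁) × Hg(X₂)` or `Hom(X₂, X₁) ≠ 0`.» For `X₂ = E` an elliptic curve with
`End⁰(E) = ℚ`: `hg(E) = 𝔰𝔩₂(ℚ)` (Remark (3.5), Borovoi), `V_E` its standard representation; this is the case used
in Prop. (3.8) («If `End⁰(E) = ℚ` then we apply Lemma (3.4)»).

THIS FILE: THE LIE STEP OF LEMMA (3.4) FOR `X₂ = E` WITHOUT ALGEBRAIC GROUPS, in the tree's word model
(`HodgeThetaAnnihilatorLieAlgebra`, THEOREM L), with the SAME output shape as the tree's R5 Lie step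
`HodgeThetaAnnihilatorPerfectTimesAbelian.wordDerAt_incl_proj_eq_zero_of_forall_lie` (so that the geometric
evaluation pipeline `NoTypeIVTimesCM{Invariance, ProductSpan}` runs verbatim). SETTING: a `ℚ`-space `U`
presented as `V₁ ⊕ V₂` (`ι₁, π₁, ι₂, π₂`); EFFECTIVE WEIGHT-ONE Hodge structures `H_U`, `H₁`, `H₂` with `ι₁`,
`ι₂` compatible with the Hodge pieces; polarizations `ψ₁`, `ψ₂`; on `V₂`: `dim_ℚ V₂ = 2` and
`End_Hdg(V₂) = ℚ` (the `H¹` of an elliptic curve without complex multiplication); and (HOM) every `ℚ`-linear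
`f : V₂ → V₁` mapping `V₂^{p,q}` into `V₁^{p,q}` vanishes («`Hom(E, X) = 0`», through Riemann's theorem). MAIN
RESULTS: for the rational annihilator algebra `𝔞` of a rational coefficient tensor `q` on `U` killed slice by slice
by `Θ_U` (`annLie` for the orthogonal sum `ψ₁(π₁·,π₁·) + ψ₂(π₂·,π₂·)` and the Hodge endomorphisms `ι₁ a π₁`, the
two projectors): `ι₂ Z π₂ ∈ 𝔞` for EVERY rational `ψ₂`-skew `Z` and `ι₁ c₁X π₁ ∈ 𝔞` for every `X ∈ 𝔞`
(`incl_corner_mem_annLie_of_times_nonCMCurve`: «`Hg(X × E) ⊇ 1 × Hg(E) = 1 × SL₂`»), hence the partial Hodge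
operator `ι₁ Θ₁ π₁` kills `q` (`wordDerAt_incl_proj_theta_eq_zero_of_times_nonCMCurve`) and so does `ι₂ Y π₂` for
every `ψ₂`-skew `Y` (`wordDerAt_incl₂_eq_zero_of_times_nonCMCurve`).

PROOF (Moonen–Zarhin (3.1), (3.3), (3.4) in Lie form, on the annihilator algebra). `𝔞` is bracket-closed, block
diagonal, `Θ_U ∈ 𝔞_ℂ` (descent). The second corner algebra `𝔤₂ = c₂(𝔞) ⊆ 𝔰𝔭(V₂, ψ₂)` is bracket-closed with
`Θ₂ ∈ (𝔤₂)_ℂ`, hence `(𝔤₂)_ℂ = 𝔰𝔩(V₂ ⊗ ℂ)` (§1, RANK-TWO RIGIDITY: `V₂ ⊗ ℂ` is `𝔤₂`-irreducible because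
`End_Hdg(V₂) = ℚ`, `SymplecticTheta.eq_bot_or_top_of_stable`; a `2 × 2` computation in a Hodge basis). The kernel
`K = 𝔞 ∩ ker c₁` maps to an ideal of `𝔤₂`; if `K ≠ 0` it contains `Θ₂` after `⊗ ℂ` («`𝔰𝔩₂` is simple»:
`SymplecticIdeal.theta_mem_of_ne_bot_hodge`) and is everything by rigidity, which gives the theorem. THE GRAPH CASE
`K = 0` (§3) is impossible: then `c₁` is injective on `𝔞` (and on `𝔞_ℂ`, §0); the ideal `𝔨₁ = c₁(𝔞 ∩ ker c₂)` of
the `Θ₁`-subalgebra `𝔤₁ = c₁(𝔞) ⊆ 𝔰𝔭(V₁, ψ₁)` has a COMPLEMENTARY IDEAL `𝔤₃` (§2: the trace form `tr(XY)` of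
`V₁` restricted to an ideal of a `Θ`-subalgebra is non-degenerate, because the ideal's complex span is stable
under the Hodge-form adjoint `X ↦ −Θ X Θ = -C X C⁻¹` and `tr(X X†) > 0` — the tree's any-weight positivity lemma
`AnyWeight.eq_zero_of_forall_trace_mul_eq_zero`; Deligne I 3.6 «`Hg` is reductive» in the Lie form needed here),
so `𝔞₃ = 𝔞 ∩ c₁⁻¹(𝔤₃)` is an ideal of `𝔞` with `𝔞 ⊆ (𝔞 ∩ ker c₂) + 𝔞₃`, `c₂` injective on `𝔞₃` and
`c₂(𝔞₃)_ℂ = 𝔰𝔩(V₂ ⊗ ℂ) = ⟨e₂, f₂, Θ₂⟩` (`e₂ : v₋ ↦ v₊`, `f₂ : v₊ ↦ v₋` in a Hodge basis `v₊, v₋`). Lift `e₂`,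
`f₂` to `X_e, X_f ∈ (𝔞₃)_ℂ` and symmetrise by `Ad(Θ_U)` (`Θ_U X_e = X_e = -X_e Θ_U`, `Θ_U X_f = -X_f = -X_f Θ_U`;
`Θ Y Θ ∈ (𝔞₃)_ℂ` for an ideal); then `(𝔞₃)_ℂ = ⟨X_e, X_f, [X_e, X_f]⟩` and the `𝔰𝔩₂`-relations hold in `(𝔞₃)_ℂ`
(`c₂`-injectivity). The first corners `E, F` of `X_e, X_f` on `V₁ ⊗ ℂ` satisfy `Θ₁E = E = -EΘ₁` (so
`Im E ⊆ V₁^{1,0} ⊆ ker E`, `E² = 0`), `Θ₁F = -F = -FΘ₁` (`F² = 0`), `EFE = E` (from `[[X_e,X_f],X_e] = 2X_e`) and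
`E ≠ 0` (injectivity of `c₁`) — the `J`-eigenvalue bookkeeping of Lemma (3.3). EVERY RATIONAL `Z` COMMUTING WITH
`𝔞₃` HAS `π₁ Z ι₂ = 0`: its complexification `f` intertwines `e₂, f₂` with `E, F`, so `f v₊ = f(e₂ v₋) = E(f v₋) ∈
V₁^{1,0}` and `f v₋ = F(f v₊) ∈ V₁^{0,1}`, i.e. `f` intertwines `Θ₂` with `Θ₁` and (HOM) applies
(`eq_zero_of_theta_comp_eq_of_hom_eq_zero`). But for `u` with `w = Eu ≠ 0` the complex operator `Z' = ι₁ F_w π₂`,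
`F_w v₊ = w`, `F_w v₋ = Fw`, is non-zero with `π₁ Z' ι₂ = F_w` and commutes with `X_e`, `X_f`, hence with `(𝔞₃)_ℂ`
— so by DESCENT OF COMMUTANTS (`mem_span_baseChange_of_forall_commute`, Deligne I §3) it lies in the complex span
of the rational `Z` commuting with `𝔞₃`, all of which have `π₁ Z ι₂ = 0`: contradiction.

CONTENTS (all proved; no definition, no named fact):
* §0 complex spans: `finrank_spanC_eq` (`dim_ℂ 𝔤_ℂ = dim_ℚ 𝔤`, flatness), corner images of complex spans
  (`map_mem_spanC_map`, `exists_mem_spanC_map_eq`), injectivity of complexified corner maps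
  (`eq_zero_of_map_eq_zero_of_mem_spanC`), `Θ Y Θ` in the span of an ideal, complex corner calculus;
* §1 RANK TWO (`RankTwoTheta.…`): Hodge basis `(v₊, v₋)`, `ψ₂`-values, `e₂`, `f₂`, trace-zero of skew operators,
  `Y = y₀₁e₂ + y₁₀f₂ + y₀₀Θ₂`, and RIGIDITY `RankTwoTheta.mem_spanC_of_skew`;
* §2 `eq_zero_of_forall_trace_mul_eq_zero_of_thetaStable` (trace-isotropic `Θ`-stable subspaces of `𝔰𝔭(V, ψ)`
  vanish) and `exists_ideal_compl` (ideals of `Θ`-subalgebras have complementary ideals — Deligne I 3.6 «`Hg` is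
  reductive», Lie form, for every admissible `𝔤`);
* §3 the Goursat step under (HOM) `goursat_incl_corner_mem_of_hom_eq_zero`;
* §4 `eq_zero_of_theta_comp_eq_of_hom_eq_zero` ((HOM) in `Θ`-form) and the MAIN THEOREMS
  `incl_corner_mem_annLie_of_times_nonCMCurve`, `incl₂_comp_proj_mem_spanC_annLie_of_times_nonCMCurve`,
  `wordDerAt_incl₂_eq_zero_of_times_nonCMCurve`, `incl₁_theta_proj_mem_spanC_annLie_of_times_nonCMCurve`,
  `wordDerAt_incl_proj_theta_eq_zero_of_times_nonCMCurve`.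

## References

* [MoonenZarhin1999LowDim] B. Moonen, Yu. G. Zarhin, Math. Ann. 315 (1999) 711–733, §3 (3.1), Lemma (3.3),
  Lemma (3.4), Remark (3.5), Prop. (3.8) (held: `paper:arxiv-math_9901113` pp. 6–7).
  [cite: MoonenZarhin1999LowDim, §3 Lemma (3.4)]
* [Deligne1982HodgeCycles] P. Deligne, *Hodge cycles on abelian varieties*, LNM 900 (1982), I §3 (proof of Prop.
  3.4: rational structures, base change), Prop. 3.6 (`Hg` reductive). [cite: Deligne1982HodgeCycles, I §3 Prop. 3.4 and Prop. 3.6]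
* [Hazama1989] F. Hazama, Duke Math. J. 58 (1989) 31–37 (Goursat for Hodge Lie algebras).
  [cite: Hazama1989, Thm. (= Gordon 7.6.2)]
* [Humphreys1972] J. E. Humphreys, GTM 9 (1972), §5.1 (non-degenerate trace forms and ideals), §7.2 (`𝔰𝔩₂`-modules:
  `[h,e] = 2e`, `[h,f] = -2f`, `[e,f] = h`). [cite: Humphreys1972, §5.1 and §7.2]
-/

noncomputable section

open scoped TensorProduct
open CategoryTheory Module

namespace Literature.AlgebraicGeometry.Motives

namespace HodgeStructure

open Literature.RepresentationTheory.GeneralLinear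

/-! ### §0 Complex spans: dimension, corners, injectivity, commutation -/

section SpanC

universe u

variable {U V W : Type u} [AddCommGroup U] [Module ℚ U] [AddCommGroup V] [Module ℚ V]
  [AddCommGroup W] [Module ℚ W]

/-- **`dim_ℂ 𝔤_ℂ = dim_ℚ 𝔤`**: the complexifications of a `ℚ`-basis of a rational space of operators form a
`ℂ`-basis of its complex span (independence: `ℂ` is flat over `ℚ` and `ℂ ⊗ End_ℚ(V) ≅ End_ℂ(V_ℂ)`,
`homBaseChange_bijective`; Deligne I §3: rational structures and base change).
[cite: Deligne1982HodgeCycles, I §3 (proof of Prop. 3.4)] -/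
theorem finrank_spanC_eq [Module.Finite ℚ V] (𝔤 : Submodule ℚ (Module.End ℚ V)) :
    Module.finrank ℂ (spanC 𝔤) = Module.finrank ℚ 𝔤 := by
  classical
  set m := Module.finrank ℚ ↥𝔤
  let b : Module.Basis (Fin m) ℚ ↥𝔤 := Module.finBasis ℚ ↥𝔤
  let E : Fin m → ↥(spanC 𝔤) := fun i =>
    ⟨((b i : ↥𝔤) : Module.End ℚ V).baseChange ℂ, baseChange_mem_spanC (b i).2⟩
  -- independence of the `E i` (flatness of `ℂ/ℚ`)
  have hli : LinearIndependent ℂ E := by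
    set κ := LinearEquiv.ofBijective (homBaseChange V V) (homBaseChange_bijective (V := V) (W := V)) with hκ
    have hκapply : ∀ Z : Module.End ℚ V, κ ((1 : ℂ) ⊗ₜ[ℚ] Z) = Z.baseChange ℂ := fun Z => by
      rw [hκ, LinearEquiv.ofBijective_apply, homBaseChange_tmul, one_smul]
    have hsub : Function.Injective (𝔤.subtype.baseChange ℂ) := by
      have h := Module.Flat.lTensor_preserves_injective_linearMap (M := ℂ) 𝔤.subtype 𝔤.injective_subtype
      intro a c hac
      exact h (by simpa [LinearMap.baseChange_eq_ltensor] using hac)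
    have h0 : LinearIndependent ℂ fun i => (κ.toLinearMap ∘ₗ 𝔤.subtype.baseChange ℂ) ((b.baseChange ℂ) i) :=
      (b.baseChange ℂ).linearIndependent.map' (κ.toLinearMap ∘ₗ 𝔤.subtype.baseChange ℂ)
        (LinearMap.ker_eq_bot.2 (κ.injective.comp hsub))
    have h1 : (fun i => (κ.toLinearMap ∘ₗ 𝔤.subtype.baseChange ℂ) ((b.baseChange ℂ) i)) =
        fun i => ((E i : ↥(spanC 𝔤)) : Module.End ℂ (ℂ ⊗[ℚ] V)) := by
      funext i
      simp only [LinearMap.coe_comp, Function.comp_apply, Module.Basis.baseChange_apply, LinearMap.baseChange_tmul,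
        Submodule.coe_subtype, LinearEquiv.coe_toLinearMap, hκapply, E]
    rw [h1] at h0
    exact LinearIndependent.of_comp (spanC 𝔤).subtype h0
  -- spanning
  have hbcE : ∀ Z : ↥𝔤, (Z : Module.End ℚ V).baseChange ℂ =
      ∑ i, ((b.repr Z i : ℂ)) • ((b i : ↥𝔤) : Module.End ℚ V).baseChange ℂ := by
    intro Z
    have hZ : (Z : Module.End ℚ V) = ((∑ i, b.repr Z i • b i : ↥𝔤) : Module.End ℚ V) := by rw [b.sum_repr Z]
    rw [hZ, Submodule.coe_sum, ← LinearMap.baseChangeHom_apply, map_sum]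
    refine Finset.sum_congr rfl fun i _ => ?_
    rw [Submodule.coe_smul, map_smul, LinearMap.baseChangeHom_apply, Rat.cast_smul_eq_qsmul ℂ (b.repr Z i)]
  have hsp : ⊤ ≤ Submodule.span ℂ (Set.range E) := by
    rintro T -
    have hle : spanC 𝔤 ≤ Submodule.span ℂ (Set.range fun i => ((b i : ↥𝔤) : Module.End ℚ V).baseChange ℂ) := by
      rw [spanC, Submodule.span_le]
      rintro _ ⟨Z, hZ, rfl⟩
      change Z.baseChange ℂ ∈ _
      rw [hbcE ⟨Z, hZ⟩]
      exact Submodule.sum_mem _ fun i _ => Submodule.smul_mem _ _ (Submodule.subset_span ⟨i, rfl⟩)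
    obtain ⟨c, hc⟩ := (Submodule.mem_span_range_iff_exists_fun ℂ).1 (hle T.2)
    have hTc : T = ∑ i, c i • E i := by
      apply Subtype.ext
      rw [← hc, Submodule.coe_sum]
      refine Finset.sum_congr rfl fun i _ => ?_
      rw [Submodule.coe_smul]
    rw [hTc]
    exact Submodule.sum_mem _ fun i _ => Submodule.smul_mem _ _ (Submodule.subset_span ⟨i, rfl⟩)
  rw [Module.finrank_eq_card_basis (Module.Basis.mk hli hsp), Fintype.card_fin]

/-- **Corners of complex spans.** For a rational linear map `L` of operator spaces with complex counterpart
`LC` (`LC X_ℂ = (L X)_ℂ`), `LC` maps `𝔞_ℂ` into `(L 𝔞)_ℂ`. [cite: Deligne1982HodgeCycles, I §3 (proof of Prop. 3.4)] -/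
theorem map_mem_spanC_map (L : Module.End ℚ U →ₗ[ℚ] Module.End ℚ V)
    (LC : Module.End ℂ (ℂ ⊗[ℚ] U) →ₗ[ℂ] Module.End ℂ (ℂ ⊗[ℚ] V))
    (hLC : ∀ X : Module.End ℚ U, LC (X.baseChange ℂ) = (L X).baseChange ℂ)
    (𝔞 : Submodule ℚ (Module.End ℚ U)) {T : Module.End ℂ (ℂ ⊗[ℚ] U)} (hT : T ∈ spanC 𝔞) :
    LC T ∈ spanC (𝔞.map L) := by
  induction hT using Submodule.span_induction with
  | mem Z hZ =>
    obtain ⟨X, hX, rfl⟩ := hZ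
    rw [hLC]
    exact baseChange_mem_spanC (Submodule.mem_map_of_mem hX)
  | zero => rw [map_zero]; exact Submodule.zero_mem _
  | add Z Z' _ _ hZ hZ' => rw [map_add]; exact Submodule.add_mem _ hZ hZ'
  | smul c Z _ hZ => rw [map_smul]; exact Submodule.smul_mem _ c hZ

/-- **… and ONTO `(L 𝔞)_ℂ`.** [cite: Deligne1982HodgeCycles, I §3 (proof of Prop. 3.4)] -/
theorem exists_mem_spanC_map_eq (L : Module.End ℚ U →ₗ[ℚ] Module.End ℚ V)
    (LC : Module.End ℂ (ℂ ⊗[ℚ] U) →ₗ[ℂ] Module.End ℂ (ℂ ⊗[ℚ] V))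
    (hLC : ∀ X : Module.End ℚ U, LC (X.baseChange ℂ) = (L X).baseChange ℂ)
    (𝔞 : Submodule ℚ (Module.End ℚ U)) {Y : Module.End ℂ (ℂ ⊗[ℚ] V)} (hY : Y ∈ spanC (𝔞.map L)) :
    ∃ T ∈ spanC 𝔞, LC T = Y := by
  induction hY using Submodule.span_induction with
  | mem Z hZ =>
    obtain ⟨X', hX', rfl⟩ := hZ
    obtain ⟨X, hX, rfl⟩ := Submodule.mem_map.1 hX'
    exact ⟨X.baseChange ℂ, baseChange_mem_spanC hX, hLC X⟩
  | zero => exact ⟨0, Submodule.zero_mem _, map_zero _⟩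
  | add Z Z' _ _ hZ hZ' =>
    obtain ⟨T, hT, rfl⟩ := hZ
    obtain ⟨T', hT', rfl⟩ := hZ'
    exact ⟨T + T', Submodule.add_mem _ hT hT', map_add _ _ _⟩
  | smul c Z _ hZ =>
    obtain ⟨T, hT, rfl⟩ := hZ
    exact ⟨c • T, Submodule.smul_mem _ c hT, map_smul _ _ _⟩

/-- **Injectivity complexifies.** If the rational `L` is injective on `𝔞`, then its complex counterpart `LC` is
injective on `𝔞_ℂ` (`dim_ℂ 𝔞_ℂ = dim_ℚ 𝔞 = dim_ℚ L(𝔞) = dim_ℂ (L 𝔞)_ℂ` and `LC` maps `𝔞_ℂ` onto `(L 𝔞)_ℂ`).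
[cite: Deligne1982HodgeCycles, I §3 (proof of Prop. 3.4)] -/
theorem eq_zero_of_map_eq_zero_of_mem_spanC [Module.Finite ℚ U] [Module.Finite ℚ V]
    (L : Module.End ℚ U →ₗ[ℚ] Module.End ℚ V)
    (LC : Module.End ℂ (ℂ ⊗[ℚ] U) →ₗ[ℂ] Module.End ℂ (ℂ ⊗[ℚ] V))
    (hLC : ∀ X : Module.End ℚ U, LC (X.baseChange ℂ) = (L X).baseChange ℂ)
    (𝔞 : Submodule ℚ (Module.End ℚ U)) (hinj : ∀ X ∈ 𝔞, L X = 0 → X = 0)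
    {T : Module.End ℂ (ℂ ⊗[ℚ] U)} (hT : T ∈ spanC 𝔞) (hT0 : LC T = 0) : T = 0 := by
  classical
  -- the restricted complex map `𝔞_ℂ → (L 𝔞)_ℂ`, onto
  set f : ↥(spanC 𝔞) →ₗ[ℂ] ↥(spanC (𝔞.map L)) :=
    (LC.domRestrict (spanC 𝔞)).codRestrict (spanC (𝔞.map L))
      (fun Z => map_mem_spanC_map L LC hLC 𝔞 Z.2) with hf
  have hfapply : ∀ Z : ↥(spanC 𝔞), (f Z : Module.End ℂ (ℂ ⊗[ℚ] V)) = LC Z := fun Z => rfl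
  have hfsurj : Function.Surjective f := by
    rintro ⟨Y, hY⟩
    obtain ⟨T', hT', hT'Y⟩ := exists_mem_spanC_map_eq L LC hLC 𝔞 hY
    exact ⟨⟨T', hT'⟩, Subtype.ext (by rw [hfapply]; exact hT'Y)⟩
  -- dimensions: `dim (L 𝔞) = dim 𝔞` by injectivity, and complex spans have the same dimensions
  have hker : LinearMap.ker (L.domRestrict 𝔞) = ⊥ := by
    rw [eq_bot_iff]
    rintro ⟨X, hX⟩ h
    rw [LinearMap.mem_ker, LinearMap.domRestrict_apply] at h
    rw [Submodule.mem_bot]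
    exact Subtype.ext (hinj X hX h)
  have hrn := LinearMap.finrank_range_add_finrank_ker (L.domRestrict 𝔞)
  rw [hker, finrank_bot, add_zero, LinearMap.range_domRestrict] at hrn
  have hA : Module.finrank ℂ ↥(spanC 𝔞) = Module.finrank ℂ ↥(spanC (𝔞.map L)) := by
    rw [finrank_spanC_eq, finrank_spanC_eq, hrn]
  have hfinj : Function.Injective f :=
    (LinearMap.injective_iff_surjective_of_finrank_eq_finrank (K := ℂ) (V := ↥(spanC 𝔞))
      (V₂ := ↥(spanC (𝔞.map L))) (f := f) hA).2 hfsurj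
  have h0 : f ⟨T, hT⟩ = 0 := Subtype.ext (by rw [hfapply]; exact hT0)
  have h1 : (⟨T, hT⟩ : ↥(spanC 𝔞)) = 0 := hfinj (by rw [h0, map_zero])
  exact congrArg Subtype.val h1

/-- **`Θ Y Θ ∈ 𝔨_ℂ` for `Y ∈ 𝔨_ℂ`** when `𝔨` is an ideal of a rational `𝔤` with `Θ ∈ 𝔤_ℂ`, `Θ² = 1`
(`Θ Y Θ = Y − ½[Θ,[Θ,Y]]`). [cite: Deligne1982HodgeCycles, I §3 Prop. 3.6] -/
theorem theta_mul_mul_theta_mem_spanC_of_ideal {𝔤 𝔨 : Submodule ℚ (Module.End ℚ U)}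
    (hideal : ∀ X ∈ 𝔤, ∀ Y ∈ 𝔨, X * Y - Y * X ∈ 𝔨) {Θ : Module.End ℂ (ℂ ⊗[ℚ] U)} (hΘ𝔤 : Θ ∈ spanC 𝔤)
    (hΘΘ : Θ * Θ = 1) {Y : Module.End ℂ (ℂ ⊗[ℚ] U)} (hY : Y ∈ spanC 𝔨) : Θ * Y * Θ ∈ spanC 𝔨 := by
  have hb1 : Θ * Y - Y * Θ ∈ spanC 𝔨 := bracket_mem_spanC_of_forall hideal hΘ𝔤 hY
  have hb2 : Θ * (Θ * Y - Y * Θ) - (Θ * Y - Y * Θ) * Θ ∈ spanC 𝔨 := bracket_mem_spanC_of_forall hideal hΘ𝔤 hb1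
  have e : Θ * Y * Θ = Y - (1 / 2 : ℂ) • (Θ * (Θ * Y - Y * Θ) - (Θ * Y - Y * Θ) * Θ) := by
    have e2 : Θ * (Θ * Y - Y * Θ) - (Θ * Y - Y * Θ) * Θ = (2 : ℂ) • Y - (2 : ℂ) • (Θ * Y * Θ) := by
      rw [mul_sub, sub_mul, ← mul_assoc, hΘΘ, one_mul, mul_assoc Y Θ Θ, hΘΘ, mul_one, two_smul, two_smul]
      noncomm_ring
    rw [e2, smul_sub, smul_smul, smul_smul]
    norm_num
  rw [e]
  exact Submodule.sub_mem _ hY (Submodule.smul_mem _ _ hb2)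

/-- **Corners are multiplicative on block-diagonal operators (complex form)**: if `T'` commutes with the
projector `ι_ℂ π_ℂ` then `π_ℂ (T T') ι_ℂ = (π_ℂ T ι_ℂ)(π_ℂ T' ι_ℂ)`. [cite: MoonenZarhin1999LowDim, §3 (3.1)] -/
theorem cornerC_mul {ι : V →ₗ[ℚ] U} {π : U →ₗ[ℚ] V} (hπι : π ∘ₗ ι = LinearMap.id)
    {T T' : Module.End ℂ (ℂ ⊗[ℚ] U)}
    (hT' : T' * (ι.baseChange ℂ ∘ₗ π.baseChange ℂ) = (ι.baseChange ℂ ∘ₗ π.baseChange ℂ) * T') :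
    π.baseChange ℂ ∘ₗ (T * T') ∘ₗ ι.baseChange ℂ =
      (π.baseChange ℂ ∘ₗ T ∘ₗ ι.baseChange ℂ) * (π.baseChange ℂ ∘ₗ T' ∘ₗ ι.baseChange ℂ) := by
  apply LinearMap.ext
  intro x
  have h1 : ∀ y, π.baseChange ℂ (ι.baseChange ℂ y) = y := fun y => proj_incl_baseChange hπι y
  have h2 : T' (ι.baseChange ℂ x) = ι.baseChange ℂ (π.baseChange ℂ (T' (ι.baseChange ℂ x))) := by
    have h := congrArg (fun f : Module.End ℂ (ℂ ⊗[ℚ] U) => f (ι.baseChange ℂ x)) hT'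
    simp only [Module.End.mul_apply, LinearMap.comp_apply, h1] at h
    exact h
  simp only [LinearMap.comp_apply, Module.End.mul_apply]
  conv_lhs => rw [h2]

/-- Complexified block decomposition: `X_ℂ = ι₁,ℂ (c₁X)_ℂ π₁,ℂ + ι₂,ℂ (c₂X)_ℂ π₂,ℂ` for block-diagonal `X`.
[cite: MoonenZarhin1999LowDim, §3 (3.1)] -/
theorem baseChange_eq_incl_corner_add {ι₁ : V →ₗ[ℚ] U} {π₁ : U →ₗ[ℚ] V} {ι₂ : W →ₗ[ℚ] U} {π₂ : U →ₗ[ℚ] W}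
    (hπι₁ : π₁ ∘ₗ ι₁ = LinearMap.id) (hπι₂ : π₂ ∘ₗ ι₂ = LinearMap.id)
    (hsum : ι₁ ∘ₗ π₁ + ι₂ ∘ₗ π₂ = LinearMap.id) {X : Module.End ℚ U}
    (hX₁ : X * (ι₁ ∘ₗ π₁) = (ι₁ ∘ₗ π₁) * X) (hX₂ : X * (ι₂ ∘ₗ π₂) = (ι₂ ∘ₗ π₂) * X) :
    X.baseChange ℂ = ι₁.baseChange ℂ ∘ₗ (π₁ ∘ₗ X ∘ₗ ι₁).baseChange ℂ ∘ₗ π₁.baseChange ℂ +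
      ι₂.baseChange ℂ ∘ₗ (π₂ ∘ₗ X ∘ₗ ι₂).baseChange ℂ ∘ₗ π₂.baseChange ℂ := by
  conv_lhs => rw [eq_incl_corner_add hπι₁ hπι₂ hsum hX₁ hX₂]
  simp only [LinearMap.baseChange_add, LinearMap.baseChange_comp]

/-- Elements of `𝔞_ℂ` commute with a complexified operator commuting with `𝔞` (e.g. the projectors).
[cite: Deligne1982HodgeCycles, I §3 (proof of Prop. 3.4)] -/
theorem mul_baseChange_eq_of_mem_spanC {𝔞 : Submodule ℚ (Module.End ℚ U)} {P : Module.End ℚ U}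
    (hP : ∀ X ∈ 𝔞, X * P = P * X) {T : Module.End ℂ (ℂ ⊗[ℚ] U)} (hT : T ∈ spanC 𝔞) :
    T * P.baseChange ℂ = P.baseChange ℂ * T :=
  (commute_of_mem_spanC (T := P.baseChange ℂ) (fun X hX => by
    rw [← LinearMap.baseChange_mul, ← hP X hX, LinearMap.baseChange_mul]) hT).symm

end SpanC

/-! ### §1 Rank two: the `H¹` of an elliptic curve without complex multiplication -/

section RankTwo

universe u

variable {V : Type u} [AddCommGroup V] [Module ℚ V] [Module.Finite ℚ V] {n : ℤ}

/-- **`h^{1,0} = h^{0,1} = 1` when `dim V = 2`** (effective weight one). [cite: MoonenZarhin1999LowDim, §2 (2.1)] -/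
theorem RankTwoTheta.finrank_pieces_eq_one (H : HodgeStructure V n) (hn : n = 1) (heff : H.IsEffective)
    (hV : Module.finrank ℚ V = 2) {Θ : Module.End ℂ (ℂ ⊗[ℚ] V)}
    (hΘ : ∀ p, ∀ x ∈ H.piece p (n - p), Θ x = ((2 * p - n : ℤ) : ℂ) • x) :
    Module.finrank ℂ (H.piece 1 0) = 1 ∧ Module.finrank ℂ (H.piece 0 1) = 1 := by
  subst hn
  obtain ⟨hP, hQ, hΘ10, hΘ01, -⟩ := UnitaryTheta.theta_facts H rfl heff hΘ
  have hPQ : ∀ v, (2 : ℂ)⁻¹ • (v + Θ v) + (2 : ℂ)⁻¹ • (v - Θ v) = v := fun v => by module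
  have hsup : H.piece 1 0 ⊔ H.piece 0 1 = ⊤ := by
    rw [eq_top_iff]
    intro v _
    rw [← hPQ v]
    exact Submodule.add_mem_sup (hP v) (hQ v)
  have hinf : H.piece 1 0 ⊓ H.piece 0 1 = ⊥ := by
    rw [eq_bot_iff]
    intro x hx
    rw [Submodule.mem_bot]
    have h1 := hΘ10 x hx.1
    rw [hΘ01 x hx.2, neg_eq_iff_add_eq_zero, ← two_smul ℂ x, smul_eq_zero] at h1
    exact h1.resolve_left (two_ne_zero' ℂ)
  have hsum := Submodule.finrank_sup_add_finrank_inf_eq (H.piece 1 0) (H.piece 0 1)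
  rw [hsup, hinf, finrank_top, finrank_bot, add_zero, Module.finrank_baseChange, hV] at hsum
  have hsymm : Module.finrank ℂ (H.piece 1 0) = Module.finrank ℂ (H.piece 0 1) := hodgeNumber_symm_holds H 1 0
  omega

/-- **A Hodge basis `(v₊, v₋)` of `V ⊗ ℂ`**: `v₊ ∈ V^{1,0}`, `v₋ ∈ V^{0,1}` (`dim V = 2`, effective weight one).
[cite: MoonenZarhin1999LowDim, §2 (2.1)] -/
theorem RankTwoTheta.exists_basis (H : HodgeStructure V n) (hn : n = 1) (heff : H.IsEffective)
    (hV : Module.finrank ℚ V = 2) {Θ : Module.End ℂ (ℂ ⊗[ℚ] V)}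
    (hΘ : ∀ p, ∀ x ∈ H.piece p (n - p), Θ x = ((2 * p - n : ℤ) : ℂ) • x) :
    ∃ b : Module.Basis (Fin 2) ℂ (ℂ ⊗[ℚ] V), b 0 ∈ H.piece 1 0 ∧ b 1 ∈ H.piece 0 1 := by
  obtain ⟨h10, h01⟩ := RankTwoTheta.finrank_pieces_eq_one H hn heff hV hΘ
  subst hn
  obtain ⟨-, -, hΘ10, hΘ01, -⟩ := UnitaryTheta.theta_facts H rfl heff hΘ
  have hne1 : H.piece 1 0 ≠ ⊥ := by
    intro h; rw [h, finrank_bot] at h10; exact zero_ne_one h10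
  have hne2 : H.piece 0 1 ≠ ⊥ := by
    intro h; rw [h, finrank_bot] at h01; exact zero_ne_one h01
  obtain ⟨v, hv, hv0⟩ := (Submodule.ne_bot_iff _).1 hne1
  obtain ⟨w, hw, hw0⟩ := (Submodule.ne_bot_iff _).1 hne2
  have hli : LinearIndependent ℂ ![v, w] := by
    rw [LinearIndependent.pair_iff]
    intro s t hst
    have h1 : Θ (s • v + t • w) = s • v - t • w := by
      rw [map_add, map_smul, map_smul, hΘ10 v hv, hΘ01 w hw, smul_neg, sub_eq_add_neg]
    rw [hst, map_zero] at h1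
    have hsv : s • v = 0 := by
      have h2 : s • v + t • w + (s • v - t • w) = 0 := by rw [hst, zero_add]; exact h1.symm
      have h3 : s • v + t • w + (s • v - t • w) = (2 : ℂ) • (s • v) := by module
      rw [h3] at h2
      exact (smul_eq_zero.1 h2).resolve_left two_ne_zero
    have hs : s = 0 := (smul_eq_zero.1 hsv).resolve_right hv0
    have ht : t = 0 := by
      rw [hs, zero_smul, zero_add] at hst
      exact (smul_eq_zero.1 hst).resolve_right hw0
    exact ⟨hs, ht⟩
  have hcard : Fintype.card (Fin 2) = Module.finrank ℂ (ℂ ⊗[ℚ] V) := by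
    rw [Fintype.card_fin, Module.finrank_baseChange, hV]
  refine ⟨basisOfLinearIndependentOfCardEqFinrank hli hcard, ?_, ?_⟩
  · rw [coe_basisOfLinearIndependentOfCardEqFinrank]; simpa using hv
  · rw [coe_basisOfLinearIndependentOfCardEqFinrank]; simpa using hw

omit [Module.Finite ℚ V] in
/-- Coordinates of an operator in a basis of size two: `Y (b j) = M 0 j • b 0 + M 1 j • b 1`, `M` the matrix of
`Y` (coordinates in a basis). [cite: Humphreys1972, §7.2] -/
theorem RankTwoTheta.apply_basis_eq (b : Module.Basis (Fin 2) ℂ (ℂ ⊗[ℚ] V)) (Y : Module.End ℂ (ℂ ⊗[ℚ] V))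
    (j : Fin 2) :
    Y (b j) = LinearMap.toMatrix b b Y 0 j • b 0 + LinearMap.toMatrix b b Y 1 j • b 1 := by
  have h := (b.sum_repr (Y (b j))).symm
  rw [Fin.sum_univ_two] at h
  simpa only [LinearMap.toMatrix_apply] using h

omit [Module.Finite ℚ V] in
/-- **`ψ_ℂ` on a Hodge basis of a rank-two weight-one structure**: `ψ(v₊,v₊) = ψ(v₋,v₋) = 0`,
`ψ(v₋,v₊) = −ψ(v₊,v₋)` and `ψ(v₊,v₋) ≠ 0` (alternating and non-degenerate). [cite: VoisinHodgeI2002, §7.1.2] -/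
theorem RankTwoTheta.form_basis (H : HodgeStructure V n) (hn : n = 1) (ψ : H.Polarization)
    (b : Module.Basis (Fin 2) ℂ (ℂ ⊗[ℚ] V)) :
    ψ.form.baseChange ℂ (b 0) (b 0) = 0 ∧ ψ.form.baseChange ℂ (b 1) (b 1) = 0 ∧
      ψ.form.baseChange ℂ (b 1) (b 0) = -ψ.form.baseChange ℂ (b 0) (b 1) ∧
      ψ.form.baseChange ℂ (b 0) (b 1) ≠ 0 := by
  subst hn
  have hswap : ∀ x y : ℂ ⊗[ℚ] V, ψ.form.baseChange ℂ y x = -ψ.form.baseChange ℂ x y :=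
    form_baseChange_swap_of_odd H odd_one ψ
  have hself : ∀ x : ℂ ⊗[ℚ] V, ψ.form.baseChange ℂ x x = 0 := fun x => by
    have h := hswap x x
    rwa [eq_neg_iff_add_eq_zero, add_self_eq_zero] at h
  refine ⟨hself _, hself _, hswap _ _, fun h01 => ?_⟩
  -- all matrix coefficients vanish, contradicting non-degeneracy at `b 0`
  have hzero : ∀ y, ψ.form.baseChange ℂ (b 0) y = 0 := by
    intro y
    rw [← b.sum_repr y, Fin.sum_univ_two, map_add, map_smul, map_smul, hself, h01, smul_zero, smul_zero,
      add_zero]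
  exact b.ne_zero 0 (ψ.eq_zero_of_forall_form_eq_zero hzero)

omit [Module.Finite ℚ V] in
/-- **A `ψ_ℂ`-skew operator of a rank-two weight-one structure is trace-free** in a Hodge basis:
`M₀₀ + M₁₁ = 0` (evaluate skewness at `(v₊, v₋)`). [cite: MoonenZarhin1999LowDim, §2 (2.1)] -/
theorem RankTwoTheta.trace_eq_zero_of_skew (H : HodgeStructure V n) (hn : n = 1) (ψ : H.Polarization)
    (b : Module.Basis (Fin 2) ℂ (ℂ ⊗[ℚ] V)) {Y : Module.End ℂ (ℂ ⊗[ℚ] V)}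
    (hY : ∀ x y, ψ.form.baseChange ℂ (Y x) y + ψ.form.baseChange ℂ x (Y y) = 0) :
    LinearMap.toMatrix b b Y 0 0 + LinearMap.toMatrix b b Y 1 1 = 0 := by
  obtain ⟨h00, h11, h10, h01⟩ := RankTwoTheta.form_basis H hn ψ b
  have h := hY (b 0) (b 1)
  rw [RankTwoTheta.apply_basis_eq b Y 0, RankTwoTheta.apply_basis_eq b Y 1] at h
  simp only [map_add, map_smul, LinearMap.add_apply, LinearMap.smul_apply, smul_eq_mul, h00, h11,
    mul_zero, add_zero, zero_add] at h
  have h' : (LinearMap.toMatrix b b Y 0 0 + LinearMap.toMatrix b b Y 1 1) * ψ.form.baseChange ℂ (b 0) (b 1) = 0 := by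
    linear_combination h
  exact (mul_eq_zero.1 h').resolve_right h01

omit [Module.Finite ℚ V] in
/-- **The raising operator `e₂ : v₊ ↦ 0, v₋ ↦ v₊` is `ψ_ℂ`-skew** (and so is the lowering operator `f₂`).
[cite: Humphreys1972, §7.2] -/
theorem RankTwoTheta.constr_skew (H : HodgeStructure V n) (hn : n = 1) (ψ : H.Polarization)
    (b : Module.Basis (Fin 2) ℂ (ℂ ⊗[ℚ] V)) :
    (∀ x y, ψ.form.baseChange ℂ (b.constr ℂ ![(0 : ℂ ⊗[ℚ] V), b 0] x) y +
        ψ.form.baseChange ℂ x (b.constr ℂ ![(0 : ℂ ⊗[ℚ] V), b 0] y) = 0) ∧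
      ∀ x y, ψ.form.baseChange ℂ (b.constr ℂ ![b 1, (0 : ℂ ⊗[ℚ] V)] x) y +
        ψ.form.baseChange ℂ x (b.constr ℂ ![b 1, (0 : ℂ ⊗[ℚ] V)] y) = 0 := by
  classical
  obtain ⟨h00, h11, h10, h01⟩ := RankTwoTheta.form_basis H hn ψ b
  have he0 : b.constr ℂ ![(0 : ℂ ⊗[ℚ] V), b 0] (b 0) = 0 := by simp
  have he1 : b.constr ℂ ![(0 : ℂ ⊗[ℚ] V), b 0] (b 1) = b 0 := by simp
  have hf0 : b.constr ℂ ![b 1, (0 : ℂ ⊗[ℚ] V)] (b 0) = b 1 := by simp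
  have hf1 : b.constr ℂ ![b 1, (0 : ℂ ⊗[ℚ] V)] (b 1) = 0 := by simp
  constructor
  · have hB : ψ.form.baseChange ℂ ∘ₗ b.constr ℂ ![(0 : ℂ ⊗[ℚ] V), b 0] +
        (ψ.form.baseChange ℂ).compl₂ (b.constr ℂ ![(0 : ℂ ⊗[ℚ] V), b 0]) = 0 :=
      LinearMap.BilinForm.ext_basis b fun i j => by
        fin_cases i <;> fin_cases j <;>
          simp [LinearMap.compl₂_apply, he0, he1, h00, h10]
    intro x y
    have h := LinearMap.congr_fun (LinearMap.congr_fun hB x) y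
    simpa only [LinearMap.add_apply, LinearMap.comp_apply, LinearMap.compl₂_apply, LinearMap.zero_apply] using h
  · have hB : ψ.form.baseChange ℂ ∘ₗ b.constr ℂ ![b 1, (0 : ℂ ⊗[ℚ] V)] +
        (ψ.form.baseChange ℂ).compl₂ (b.constr ℂ ![b 1, (0 : ℂ ⊗[ℚ] V)]) = 0 :=
      LinearMap.BilinForm.ext_basis b fun i j => by
        fin_cases i <;> fin_cases j <;>
          simp [LinearMap.compl₂_apply, hf0, hf1, h11, h10]
    intro x y
    have h := LinearMap.congr_fun (LinearMap.congr_fun hB x) y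
    simpa only [LinearMap.add_apply, LinearMap.comp_apply, LinearMap.compl₂_apply, LinearMap.zero_apply] using h

omit [Module.Finite ℚ V] in
/-- **`𝔰𝔩₂ = ⟨e, f, h⟩`**: a `ψ_ℂ`-skew operator of a rank-two weight-one structure is
`Y = M₀₁ e₂ + M₁₀ f₂ + M₀₀ Θ` in a Hodge basis (`Θ = diag(1, −1)`). [cite: Humphreys1972, §7.2] -/
theorem RankTwoTheta.eq_of_skew (H : HodgeStructure V n) (hn : n = 1) (heff : H.IsEffective)
    (ψ : H.Polarization) (b : Module.Basis (Fin 2) ℂ (ℂ ⊗[ℚ] V)) (hb0 : b 0 ∈ H.piece 1 0)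
    (hb1 : b 1 ∈ H.piece 0 1) {Θ : Module.End ℂ (ℂ ⊗[ℚ] V)}
    (hΘ : ∀ p, ∀ x ∈ H.piece p (n - p), Θ x = ((2 * p - n : ℤ) : ℂ) • x) {Y : Module.End ℂ (ℂ ⊗[ℚ] V)}
    (hY : ∀ x y, ψ.form.baseChange ℂ (Y x) y + ψ.form.baseChange ℂ x (Y y) = 0) :
    Y = LinearMap.toMatrix b b Y 0 1 • b.constr ℂ ![(0 : ℂ ⊗[ℚ] V), b 0] +
      LinearMap.toMatrix b b Y 1 0 • b.constr ℂ ![b 1, (0 : ℂ ⊗[ℚ] V)] + LinearMap.toMatrix b b Y 0 0 • Θ := by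
  classical
  have htr := RankTwoTheta.trace_eq_zero_of_skew H hn ψ b hY
  subst hn
  obtain ⟨-, -, hΘ10, hΘ01, -⟩ := UnitaryTheta.theta_facts H rfl heff hΘ
  have hΘb0 : Θ (b 0) = b 0 := hΘ10 _ hb0
  have hΘb1 : Θ (b 1) = -b 1 := hΘ01 _ hb1
  have h11 : LinearMap.toMatrix b b Y 1 1 = -LinearMap.toMatrix b b Y 0 0 := by linear_combination htr
  have he0 : b.constr ℂ ![(0 : ℂ ⊗[ℚ] V), b 0] (b 0) = 0 := by simp
  have he1 : b.constr ℂ ![(0 : ℂ ⊗[ℚ] V), b 0] (b 1) = b 0 := by simp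
  have hf0 : b.constr ℂ ![b 1, (0 : ℂ ⊗[ℚ] V)] (b 0) = b 1 := by simp
  have hf1 : b.constr ℂ ![b 1, (0 : ℂ ⊗[ℚ] V)] (b 1) = 0 := by simp
  refine b.ext fun j => ?_
  fin_cases j
  · rw [show ((⟨0, by norm_num⟩ : Fin 2)) = 0 from rfl, RankTwoTheta.apply_basis_eq b Y 0]
    simp only [LinearMap.add_apply, LinearMap.smul_apply, he0, hf0, hΘb0, smul_zero, zero_add]
    module
  · rw [show ((⟨1, by norm_num⟩ : Fin 2)) = 1 from rfl, RankTwoTheta.apply_basis_eq b Y 1, h11]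
    simp only [LinearMap.add_apply, LinearMap.smul_apply, he1, hf1, hΘb1, smul_zero, add_zero, smul_neg]
    module

/-- **RANK-TWO RIGIDITY (`hg(E) = 𝔰𝔩₂` for a non-CM elliptic curve, for every admissible rational Lie algebra).**
Let `H` be an effective polarized weight-one `ℚ`-Hodge structure with `dim V = 2` and `End_Hdg(V) = ℚ`, and let
`𝔤 ⊆ End_ℚ(V)` be a bracket-closed `ℚ`-subspace of `ψ`-skew operators whose complex span contains the Hodge
operator `Θ`. Then EVERY `ψ_ℂ`-skew operator of `V ⊗ ℂ` lies in `𝔤_ℂ`. PROOF: `V ⊗ ℂ` is `𝔤`-irreducible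
(`SymplecticTheta.eq_bot_or_top_of_stable`), so some `X ∈ 𝔤` moves the line `ℂ v₋` (resp. `ℂ v₊`); then
`¼(X − ΘXΘ ± [Θ, X]) ∈ 𝔤_ℂ` is a non-zero multiple of `e₂` (resp. `f₂`), and `Y = y₀₁e₂ + y₁₀f₂ + y₀₀Θ`.
(Moonen–Zarhin Remark (3.5): «Borovoi: `hg(X)` is `ℚ`-simple if `End⁰(X) = ℚ`»; for `g = 1`, `Hg(E) = SL₂`.)
[cite: MoonenZarhin1999LowDim, §2 (2.1) and §3 Remark (3.5)] [cite: Deligne1982HodgeCycles, I §3 Prop. 3.4] -/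
theorem RankTwoTheta.mem_spanC_of_skew (H : HodgeStructure V n) (hn : n = 1) (heff : H.IsEffective)
    (ψ : H.Polarization) (hE : ∀ a ∈ H.endAlg, ∃ x : ℚ, a = x • 1) (hV : Module.finrank ℚ V = 2)
    (𝔤 : Submodule ℚ (Module.End ℚ V)) (hbr : ∀ X ∈ 𝔤, ∀ X' ∈ 𝔤, X * X' - X' * X ∈ 𝔤)
    {Θ : Module.End ℂ (ℂ ⊗[ℚ] V)} (hΘ : ∀ p, ∀ x ∈ H.piece p (n - p), Θ x = ((2 * p - n : ℤ) : ℂ) • x)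
    (hΘ𝔤 : Θ ∈ spanC 𝔤) (hskew : ∀ X ∈ 𝔤, ∀ v w, ψ.form (X v) w + ψ.form v (X w) = 0)
    {Y : Module.End ℂ (ℂ ⊗[ℚ] V)}
    (hYskew : ∀ x y, ψ.form.baseChange ℂ (Y x) y + ψ.form.baseChange ℂ x (Y y) = 0) : Y ∈ spanC 𝔤 := by
  classical
  obtain ⟨b, hb0, hb1⟩ := RankTwoTheta.exists_basis H hn heff hV hΘ
  have hdec := RankTwoTheta.eq_of_skew H hn heff ψ b hb0 hb1 hΘ hYskew
  have hirr : ∀ L : Submodule ℂ (ℂ ⊗[ℚ] V), (∀ X ∈ 𝔤, ∀ u ∈ L, X.baseChange ℂ u ∈ L) → L = ⊥ ∨ L = ⊤ :=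
    fun L hL => SymplecticTheta.eq_bot_or_top_of_stable H hn heff ψ hE 𝔤 hΘ hΘ𝔤 hskew hL
  subst hn
  obtain ⟨-, -, hΘ10, hΘ01, hΘΘ'⟩ := UnitaryTheta.theta_facts H rfl heff hΘ
  have hΘΘ : Θ * Θ = 1 := LinearMap.ext fun v => hΘΘ' v
  have hΘb0 : Θ (b 0) = b 0 := hΘ10 _ hb0
  have hΘb1 : Θ (b 1) = -b 1 := hΘ01 _ hb1
  have hdimV : Module.finrank ℂ (ℂ ⊗[ℚ] V) = 2 := by rw [Module.finrank_baseChange, hV]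
  -- a line `ℂ b i` is neither `⊥` nor `⊤`
  have hline : ∀ i : Fin 2, (ℂ ∙ b i) ≠ ⊥ ∧ (ℂ ∙ b i) ≠ ⊤ := by
    intro i
    refine ⟨fun h => b.ne_zero i ((Submodule.span_singleton_eq_bot).1 h), fun h => ?_⟩
    have h1 : Module.finrank ℂ (ℂ ∙ b i) = 1 := finrank_span_singleton (b.ne_zero i)
    rw [h, finrank_top, hdimV] at h1
    exact absurd h1 (by norm_num)
  -- set-up: coordinates of `X_ℂ`, `X ∈ 𝔤`, and the four auxiliary operators in `𝔤_ℂ`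
  set e₂ := b.constr ℂ ![(0 : ℂ ⊗[ℚ] V), b 0] with he₂
  set f₂ := b.constr ℂ ![b 1, (0 : ℂ ⊗[ℚ] V)] with hf₂
  have he0 : e₂ (b 0) = 0 := by simp [he₂]
  have he1 : e₂ (b 1) = b 0 := by simp [he₂]
  have hf0 : f₂ (b 0) = b 1 := by simp [hf₂]
  have hf1 : f₂ (b 1) = 0 := by simp [hf₂]
  have hmem𝔤 : ∀ X ∈ 𝔤, X.baseChange ℂ - Θ * X.baseChange ℂ * Θ ∈ spanC 𝔤 ∧
      Θ * X.baseChange ℂ - X.baseChange ℂ * Θ ∈ spanC 𝔤 := fun X hX =>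
    ⟨Submodule.sub_mem _ (baseChange_mem_spanC hX)
      (theta_mul_mul_theta_mem_spanC hbr hΘ𝔤 hΘΘ (baseChange_mem_spanC hX)),
      commutator_mem_spanC hbr hΘ𝔤 (baseChange_mem_spanC hX)⟩
  -- the raising operator
  have he₂mem : e₂ ∈ spanC 𝔤 := by
    -- some `X ∈ 𝔤` moves the line `ℂ v₋`
    obtain ⟨X, hX, hX01⟩ : ∃ X ∈ 𝔤, LinearMap.toMatrix b b (X.baseChange ℂ) 0 1 ≠ 0 := by
      by_contra hall
      push Not at hall
      have hst : ∀ X ∈ 𝔤, ∀ u ∈ (ℂ ∙ b 1), X.baseChange ℂ u ∈ (ℂ ∙ b 1) := by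
        intro X hX u hu
        obtain ⟨c, rfl⟩ := Submodule.mem_span_singleton.1 hu
        rw [map_smul, RankTwoTheta.apply_basis_eq b _ 1, hall X hX, zero_smul, zero_add]
        exact Submodule.smul_mem _ c (Submodule.smul_mem _ _ (Submodule.mem_span_singleton_self _))
      rcases hirr _ hst with h | h
      · exact (hline 1).1 h
      · exact (hline 1).2 h
    set M := LinearMap.toMatrix b b (X.baseChange ℂ) with hM
    have hXb0 := RankTwoTheta.apply_basis_eq b (X.baseChange ℂ) 0
    have hXb1 := RankTwoTheta.apply_basis_eq b (X.baseChange ℂ) 1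
    rw [← hM] at hXb0 hXb1
    -- `X − ΘXΘ + [Θ, X] = 4 M₀₁ e₂`
    have hE : X.baseChange ℂ - Θ * X.baseChange ℂ * Θ + (Θ * X.baseChange ℂ - X.baseChange ℂ * Θ) =
        (4 * M 0 1) • e₂ := by
      refine b.ext fun j => ?_
      fin_cases j
      · rw [show ((⟨0, by norm_num⟩ : Fin 2)) = 0 from rfl]
        simp only [LinearMap.add_apply, LinearMap.sub_apply, Module.End.mul_apply, LinearMap.smul_apply, hΘb0,
          hXb0, map_add, map_smul, hΘb1, he0]
        module
      · rw [show ((⟨1, by norm_num⟩ : Fin 2)) = 1 from rfl]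
        simp only [LinearMap.add_apply, LinearMap.sub_apply, Module.End.mul_apply, LinearMap.smul_apply, hΘb1,
          map_neg, hXb1, map_add, map_smul, hΘb0, he1]
        module
    have hmem : (4 * M 0 1) • e₂ ∈ spanC 𝔤 := by
      rw [← hE]
      exact Submodule.add_mem _ (hmem𝔤 X hX).1 (hmem𝔤 X hX).2
    have h4 : (4 * M 0 1) ≠ 0 := mul_ne_zero (by norm_num) hX01
    have h := Submodule.smul_mem _ (4 * M 0 1)⁻¹ hmem
    rwa [smul_smul, inv_mul_cancel₀ h4, one_smul] at h
  -- the lowering operator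
  have hf₂mem : f₂ ∈ spanC 𝔤 := by
    obtain ⟨X, hX, hX10⟩ : ∃ X ∈ 𝔤, LinearMap.toMatrix b b (X.baseChange ℂ) 1 0 ≠ 0 := by
      by_contra hall
      push Not at hall
      have hst : ∀ X ∈ 𝔤, ∀ u ∈ (ℂ ∙ b 0), X.baseChange ℂ u ∈ (ℂ ∙ b 0) := by
        intro X hX u hu
        obtain ⟨c, rfl⟩ := Submodule.mem_span_singleton.1 hu
        rw [map_smul, RankTwoTheta.apply_basis_eq b _ 0, hall X hX, zero_smul, add_zero]
        exact Submodule.smul_mem _ c (Submodule.smul_mem _ _ (Submodule.mem_span_singleton_self _))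
      rcases hirr _ hst with h | h
      · exact (hline 0).1 h
      · exact (hline 0).2 h
    set M := LinearMap.toMatrix b b (X.baseChange ℂ) with hM
    have hXb0 := RankTwoTheta.apply_basis_eq b (X.baseChange ℂ) 0
    have hXb1 := RankTwoTheta.apply_basis_eq b (X.baseChange ℂ) 1
    rw [← hM] at hXb0 hXb1
    -- `X − ΘXΘ − [Θ, X] = 4 M₁₀ f₂`
    have hF : X.baseChange ℂ - Θ * X.baseChange ℂ * Θ - (Θ * X.baseChange ℂ - X.baseChange ℂ * Θ) =
        (4 * M 1 0) • f₂ := by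
      refine b.ext fun j => ?_
      fin_cases j
      · rw [show ((⟨0, by norm_num⟩ : Fin 2)) = 0 from rfl]
        simp only [LinearMap.sub_apply, Module.End.mul_apply, LinearMap.smul_apply, hΘb0,
          hXb0, map_add, map_smul, hΘb1, hf0]
        module
      · rw [show ((⟨1, by norm_num⟩ : Fin 2)) = 1 from rfl]
        simp only [LinearMap.sub_apply, Module.End.mul_apply, LinearMap.smul_apply, hΘb1,
          map_neg, hXb1, map_add, map_smul, hΘb0, hf1]
        module
    have hmem : (4 * M 1 0) • f₂ ∈ spanC 𝔤 := by
      rw [← hF]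
      exact Submodule.sub_mem _ (hmem𝔤 X hX).1 (hmem𝔤 X hX).2
    have h4 : (4 * M 1 0) ≠ 0 := mul_ne_zero (by norm_num) hX10
    have h := Submodule.smul_mem _ (4 * M 1 0)⁻¹ hmem
    rwa [smul_smul, inv_mul_cancel₀ h4, one_smul] at h
  rw [hdec]
  exact Submodule.add_mem _ (Submodule.add_mem _ (Submodule.smul_mem _ _ he₂mem) (Submodule.smul_mem _ _ hf₂mem))
    (Submodule.smul_mem _ _ hΘ𝔤)

end RankTwo

/-! ### §2 Trace-isotropic `Θ`-stable subspaces of `𝔰𝔭(V, ψ)` vanish; the complementary ideal -/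

section Ideals

universe u

variable {V : Type u} [AddCommGroup V] [Module ℚ V] [Module.Finite ℚ V] [HodgeTensorFacts.{u, u}] {n : ℤ}

/-- **A trace-isotropic `Θ`-stable rational subspace of `𝔰𝔭(V, ψ)` is zero** (effective weight one). Let
`𝔨 ⊆ End_ℚ(V)` be a `ℚ`-subspace of `ψ`-skew operators whose complex span is stable under `Y ↦ Θ Y Θ` (e.g. an
ideal of a bracket-closed `𝔤` with `Θ ∈ 𝔤_ℂ`, `theta_mul_mul_theta_mem_spanC_of_ideal`). If `X ∈ 𝔨` has
`tr(XY) = 0` for all `Y ∈ 𝔨`, then `X = 0`: the Weil operator is `C = iΘ`, so `C Y C⁻¹ = Θ Y Θ` and the tree's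
any-weight form of Deligne's positivity argument (`AnyWeight.eq_zero_of_forall_trace_mul_eq_zero`:
`tr(X_ℂ X^*) = Σ |X_{στ}|²` with `X^* = -C X_ℂ C⁻¹ ∈ 𝔨_ℂ`) applies to `𝔨`. In particular the trace form of a
`Θ`-subalgebra is non-degenerate on each of its ideals, so ideals have complementary ideals (`exists_ideal_compl`)
— the reductivity of `Hg` (Deligne I 3.6) in the Lie form needed for Moonen–Zarhin's (3.1).
[cite: Deligne1982HodgeCycles, I §3 Prop. 3.6] [cite: MoonenZarhin1999LowDim, §3 (3.1)] -/
theorem eq_zero_of_forall_trace_mul_eq_zero_of_thetaStable (H : HodgeStructure V n) (hn : n = 1)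
    (heff : H.IsEffective) (ψ : H.Polarization) (𝔨 : Submodule ℚ (Module.End ℚ V))
    {Θ : Module.End ℂ (ℂ ⊗[ℚ] V)} (hΘ : ∀ p, ∀ x ∈ H.piece p (n - p), Θ x = ((2 * p - n : ℤ) : ℂ) • x)
    (hΘ𝔨 : ∀ Y ∈ spanC 𝔨, Θ * Y * Θ ∈ spanC 𝔨)
    (hskew : ∀ X ∈ 𝔨, ∀ v w, ψ.form (X v) w + ψ.form v (X w) = 0)
    {X : Module.End ℚ V} (hX : X ∈ 𝔨) (htr : ∀ Y ∈ 𝔨, LinearMap.trace ℚ V (X * Y) = 0) : X = 0 := by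
  refine AnyWeight.eq_zero_of_forall_trace_mul_eq_zero H ψ 𝔨 (fun C hC Y hY => ?_) hskew hX htr
  have h : (C : ℂ ⊗[ℚ] V →ₗ[ℂ] ℂ ⊗[ℚ] V) ∘ₗ Y ∘ₗ (C.symm : ℂ ⊗[ℚ] V →ₗ[ℂ] ℂ ⊗[ℚ] V) = Θ * Y * Θ := by
    apply LinearMap.ext
    intro v
    rw [LinearMap.comp_apply, LinearMap.comp_apply, LinearEquiv.coe_coe, LinearEquiv.coe_coe,
      weil_symm_apply_eq_neg_I_smul_theta H hn heff hΘ hC, map_neg, map_smul, map_neg, map_smul,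
      weil_apply_eq_I_smul_theta H hn heff hΘ hC, smul_smul, Complex.I_mul_I, neg_smul, one_smul, neg_neg,
      Module.End.mul_apply, Module.End.mul_apply]
  rw [h]
  exact hΘ𝔨 Y hY

/-- **Ideals of a `Θ`-subalgebra have complementary ideals.** Let `𝔤 ⊆ End_ℚ(V)` be bracket-closed, `ψ`-skew,
with `Θ ∈ 𝔤_ℂ` (effective weight one), and let `𝔨` be an ideal of `𝔤`. Then the trace-orthogonal
`𝔨' = {Y ∈ 𝔤 | tr(KY) = 0 for all K ∈ 𝔨}` is an ideal of `𝔤` (invariance of the trace form) with `𝔨 ∩ 𝔨' = 0`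
(`𝔨 ∩ 𝔨'` is trace-isotropic and `Θ`-stable) and `𝔨 + 𝔨' = 𝔤` (dimension count) — «`hg` is reductive, so the
kernel of `hg(X₁ × X₂) → hg(X₁)` has a complement» in Moonen–Zarhin's proof of (3.1)/(3.4).
[cite: Deligne1982HodgeCycles, I §3 Prop. 3.6] [cite: MoonenZarhin1999LowDim, §3 (3.1) and Lemma (3.4)]
[cite: Humphreys1972, §5.1] -/
theorem exists_ideal_compl (H : HodgeStructure V n) (hn : n = 1) (heff : H.IsEffective) (ψ : H.Polarization)
    (𝔤 : Submodule ℚ (Module.End ℚ V)) (hbr : ∀ X ∈ 𝔤, ∀ Y ∈ 𝔤, X * Y - Y * X ∈ 𝔤)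
    {Θ : Module.End ℂ (ℂ ⊗[ℚ] V)} (hΘ : ∀ p, ∀ x ∈ H.piece p (n - p), Θ x = ((2 * p - n : ℤ) : ℂ) • x)
    (hΘ𝔤 : Θ ∈ spanC 𝔤) (hskew : ∀ X ∈ 𝔤, ∀ v w, ψ.form (X v) w + ψ.form v (X w) = 0)
    {𝔨 : Submodule ℚ (Module.End ℚ V)} (h𝔨 : 𝔨 ≤ 𝔤) (hideal : ∀ X ∈ 𝔤, ∀ Y ∈ 𝔨, X * Y - Y * X ∈ 𝔨) :
    ∃ 𝔨' : Submodule ℚ (Module.End ℚ V), 𝔨' ≤ 𝔤 ∧ (∀ X ∈ 𝔤, ∀ Y ∈ 𝔨', X * Y - Y * X ∈ 𝔨') ∧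
      𝔨 ⊓ 𝔨' = ⊥ ∧ 𝔨 ⊔ 𝔨' = 𝔤 := by
  classical
  -- the trace form `τ X Y = tr(XY)` and the trace-orthogonal of `𝔨`
  set τ : Module.End ℚ V →ₗ[ℚ] Module.Dual ℚ (Module.End ℚ V) :=
    (LinearMap.mul ℚ (Module.End ℚ V)).compr₂ (LinearMap.trace ℚ V) with hτ
  have hτapply : ∀ X Y, τ X Y = LinearMap.trace ℚ V (X * Y) := fun X Y => rfl
  set 𝔬 : Submodule ℚ (Module.End ℚ V) := (𝔨.map τ).dualCoannihilator with h𝔬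
  have h𝔬mem : ∀ {Y}, Y ∈ 𝔬 ↔ ∀ K ∈ 𝔨, LinearMap.trace ℚ V (K * Y) = 0 := by
    intro Y
    rw [h𝔬, Submodule.mem_dualCoannihilator]
    constructor
    · intro h K hK
      rw [← hτapply]
      exact h (τ K) (Submodule.mem_map_of_mem hK)
    · rintro h _ ⟨K, hK, rfl⟩
      rw [hτapply]
      exact h K hK
  set 𝔨' : Submodule ℚ (Module.End ℚ V) := 𝔤 ⊓ 𝔬 with h𝔨'
  have h𝔨'mem : ∀ {Y}, Y ∈ 𝔨' ↔ Y ∈ 𝔤 ∧ ∀ K ∈ 𝔨, LinearMap.trace ℚ V (K * Y) = 0 := by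
    intro Y
    rw [h𝔨', Submodule.mem_inf, h𝔬mem]
  have hΘΘ : Θ * Θ = 1 := LinearMap.ext fun v => theta_theta_apply H hn heff hΘ v
  have hΘ𝔨 : ∀ Y ∈ spanC 𝔨, Θ * Y * Θ ∈ spanC 𝔨 := fun Y hY =>
    theta_mul_mul_theta_mem_spanC_of_ideal hideal hΘ𝔤 hΘΘ hY
  have hskew𝔨 : ∀ X ∈ 𝔨, ∀ v w, ψ.form (X v) w + ψ.form v (X w) = 0 := fun X hX => hskew X (h𝔨 hX)
  -- `𝔨'` is an ideal (invariance of the trace form)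
  have hideal' : ∀ X ∈ 𝔤, ∀ Y ∈ 𝔨', X * Y - Y * X ∈ 𝔨' := by
    intro X hX Y hY
    obtain ⟨hY𝔤, hYo⟩ := h𝔨'mem.1 hY
    refine h𝔨'mem.2 ⟨hbr X hX Y hY𝔤, fun K hK => ?_⟩
    rw [trace_mul_commutator_eq]
    have hKX : K * X - X * K ∈ 𝔨 := by
      rw [← neg_sub]
      exact Submodule.neg_mem _ (hideal X hX K hK)
    exact hYo _ hKX
  -- `𝔨 ∩ 𝔨' = 0` (trace-isotropic and `Θ`-stable)
  have hinf : 𝔨 ⊓ 𝔨' = ⊥ := by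
    rw [eq_bot_iff]
    intro X hX
    obtain ⟨hX𝔨, hX'⟩ := Submodule.mem_inf.1 hX
    obtain ⟨-, hXo⟩ := h𝔨'mem.1 hX'
    rw [Submodule.mem_bot]
    refine eq_zero_of_forall_trace_mul_eq_zero_of_thetaStable H hn heff ψ 𝔨 hΘ hΘ𝔨 hskew𝔨 hX𝔨 fun Y hY => ?_
    rw [LinearMap.trace_mul_comm]
    exact hXo Y hY
  -- `𝔨 + 𝔨' = 𝔤` (dimension count)
  have hdim : Module.finrank ℚ 𝔤 ≤ Module.finrank ℚ 𝔨 + Module.finrank ℚ 𝔨' := by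
    have h1 := Subspace.finrank_add_finrank_dualCoannihilator_eq (𝔨.map τ)
    have h2 : Module.finrank ℚ (𝔨.map τ) ≤ Module.finrank ℚ 𝔨 := Submodule.finrank_map_le τ 𝔨
    have h3 := Submodule.finrank_sup_add_finrank_inf_eq 𝔤 𝔬
    have h4 : Module.finrank ℚ ↥(𝔤 ⊔ 𝔬) ≤ Module.finrank ℚ (Module.End ℚ V) := Submodule.finrank_le _
    rw [← h𝔬] at h1
    rw [← h𝔨'] at h3
    omega
  have hsup : 𝔨 ⊔ 𝔨' = 𝔤 := by
    refine Submodule.eq_of_le_of_finrank_le (sup_le h𝔨 inf_le_left) ?_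
    have h5 := Submodule.finrank_sup_add_finrank_inf_eq 𝔨 𝔨'
    rw [hinf, finrank_bot, add_zero] at h5
    omega
  exact ⟨𝔨', inf_le_left, hideal', hinf, hsup⟩

end Ideals

/-! ### §3 The Goursat step for a rank-two second factor: `Hom = 0` excludes the graph -/

section Goursat

universe u

variable {U V₁ V₂ : Type u} [AddCommGroup U] [Module ℚ U] [AddCommGroup V₁] [Module ℚ V₁]
  [AddCommGroup V₂] [Module ℚ V₂] [Module.Finite ℚ U] [Module.Finite ℚ V₁] [Module.Finite ℚ V₂]
  [HodgeTensorFacts.{u, u}] {n : ℤ}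

set_option maxHeartbeats 400000 in
/-- **The Goursat step with a rank-two second factor (Moonen–Zarhin Lemma (3.4), `g = 1`, Lie form).** Let
`U = ι₁V₁ ⊕ ι₂V₂` and let `𝔞 ⊆ End_ℚ(U)` be a bracket-closed space of block-diagonal operators with `ψ_i`-skew
corners, whose complex span contains an operator `Θ_U` inducing the Hodge operators `Θ₁`, `Θ₂` of the effective
weight-one structures `H₁`, `H₂` on the blocks; `dim V₂ = 2` and `End_Hdg(V₂) = ℚ` (a non-CM elliptic curve).
If NO non-zero `ℚ`-linear `f : V₂ → V₁` intertwines `Θ₂` and `Θ₁` («`Hom(X₁, X₂) = 0`»), then `ι₁ c₁X π₁ ∈ 𝔞`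
for all `X ∈ 𝔞` and `ι₂ Z π₂ ∈ 𝔞` for every rational `ψ₂`-skew `Z` («`hg(X₁ × X₂) = hg(X₁) × hg(X₂)`»).
PROOF. As in the tree's `goursat_incl_corner_mem` once the kernel `K = 𝔞 ∩ ker c₁` is non-zero ((IDEAL)
`SymplecticIdeal.theta_mem_of_ne_bot_hodge`, (RIGID) `RankTwoTheta.mem_spanC_of_skew`, descent). If `K = 0`
(«`hg = hg(X₁) ⊕ 𝔤₃` with `𝔤₃` the graph of `hg(X₂) = 𝔰𝔩₂ → 𝔤₂ ⊂ hg(X₁)`»): the ideal `𝔨₁ = c₁(𝔞 ∩ ker c₂)` of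
`𝔤₁ = c₁(𝔞)` has a complementary ideal `𝔤₃` (`exists_ideal_compl`), `𝔞₃ = 𝔞 ∩ c₁⁻¹(𝔤₃)` is an ideal of
`𝔞` on which `c₂` is injective with `c₂(𝔞₃)_ℂ = 𝔰𝔩₂(V₂ ⊗ ℂ) = ⟨e₂, f₂, Θ₂⟩` (Hodge basis `v₊, v₋`); the lifts
`X_e, X_f ∈ (𝔞₃)_ℂ` of `e₂, f₂`, symmetrised by `Ad(Θ_U)`, have first corners `E, F` with
`Θ₁E = E = -EΘ₁`, `Θ₁F = -F = -FΘ₁`, so `E² = F² = 0`, `EFE = E` (the `𝔰𝔩₂`-relations transported by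
`c₂`-injectivity), `E ≠ 0` (`c₁`-injectivity); then `Z' = ι₁ ∘ (v₊ ↦ Eu, v₋ ↦ FEu) ∘ π₂` is a non-zero operator
of `U ⊗ ℂ` commuting with `(𝔞₃)_ℂ`, whereas every RATIONAL `Z` commuting with `𝔞₃` has `π₁Zι₂ = 0` — its
complexification intertwines `e₂, f₂` with `E, F`, hence maps `v₊` into `Im E ⊆ V₁^{1,0}` and `v₋` into
`Im F ⊆ V₁^{0,1}`, i.e. intertwines `Θ₂` and `Θ₁` («`(V₁ ⊗ V₂)^{𝔤₃}` would carry non-zero Hodge classes, i.e.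
`Hom(X₁, X₂) ≠ 0`») — contradicting descent (`mem_span_baseChange_of_forall_commute`).
[cite: MoonenZarhin1999LowDim, §3 (3.1), Lemma (3.4) and Remark (3.5)] [cite: Hazama1989, Thm. (= Gordon 7.6.2)]
[cite: Deligne1982HodgeCycles, I §3 (proof of Prop. 3.4) and Prop. 3.6] -/
theorem goursat_incl_corner_mem_of_hom_eq_zero (hn : n = 1) (H₁ : HodgeStructure V₁ n)
    (H₂ : HodgeStructure V₂ n) (heff₁ : H₁.IsEffective) (heff₂ : H₂.IsEffective)
    {ι₁ : V₁ →ₗ[ℚ] U} {π₁ : U →ₗ[ℚ] V₁} {ι₂ : V₂ →ₗ[ℚ] U} {π₂ : U →ₗ[ℚ] V₂}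
    (hπι₁ : π₁ ∘ₗ ι₁ = LinearMap.id) (hπι₂ : π₂ ∘ₗ ι₂ = LinearMap.id) (hπ₁ι₂ : π₁ ∘ₗ ι₂ = 0)
    (hπ₂ι₁ : π₂ ∘ₗ ι₁ = 0) (hsum : ι₁ ∘ₗ π₁ + ι₂ ∘ₗ π₂ = LinearMap.id)
    (𝔞 : Submodule ℚ (Module.End ℚ U)) (hbr : ∀ X ∈ 𝔞, ∀ X' ∈ 𝔞, X * X' - X' * X ∈ 𝔞)
    (hP₁ : ∀ X ∈ 𝔞, X * (ι₁ ∘ₗ π₁) = (ι₁ ∘ₗ π₁) * X) (hP₂ : ∀ X ∈ 𝔞, X * (ι₂ ∘ₗ π₂) = (ι₂ ∘ₗ π₂) * X)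
    (ψ₁ : H₁.Polarization) (ψ₂ : H₂.Polarization)
    (hskew₁ : ∀ X ∈ 𝔞, ∀ v w, ψ₁.form ((π₁ ∘ₗ X ∘ₗ ι₁) v) w + ψ₁.form v ((π₁ ∘ₗ X ∘ₗ ι₁) w) = 0)
    (hskew₂ : ∀ X ∈ 𝔞, ∀ v w, ψ₂.form ((π₂ ∘ₗ X ∘ₗ ι₂) v) w + ψ₂.form v ((π₂ ∘ₗ X ∘ₗ ι₂) w) = 0)
    (hE₂ : ∀ a ∈ H₂.endAlg, ∃ x : ℚ, a = x • 1) (hV₂ : Module.finrank ℚ V₂ = 2)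
    {Θ₁ : Module.End ℂ (ℂ ⊗[ℚ] V₁)} (hΘ₁ : ∀ p, ∀ x ∈ H₁.piece p (n - p), Θ₁ x = ((2 * p - n : ℤ) : ℂ) • x)
    {Θ₂ : Module.End ℂ (ℂ ⊗[ℚ] V₂)} (hΘ₂ : ∀ p, ∀ x ∈ H₂.piece p (n - p), Θ₂ x = ((2 * p - n : ℤ) : ℂ) • x)
    {ΘU : Module.End ℂ (ℂ ⊗[ℚ] U)} (hΘU𝔞 : ΘU ∈ spanC 𝔞)
    (hΘUι₁ : ∀ x, ΘU (ι₁.baseChange ℂ x) = ι₁.baseChange ℂ (Θ₁ x))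
    (hΘUι₂ : ∀ x, ΘU (ι₂.baseChange ℂ x) = ι₂.baseChange ℂ (Θ₂ x))
    (hHom : ∀ f : V₂ →ₗ[ℚ] V₁, Θ₁ ∘ₗ f.baseChange ℂ = f.baseChange ℂ ∘ₗ Θ₂ → f = 0) :
    (∀ X ∈ 𝔞, ι₁ ∘ₗ (π₁ ∘ₗ X ∘ₗ ι₁) ∘ₗ π₁ ∈ 𝔞) ∧
      ∀ Z₂ : Module.End ℚ V₂, (∀ v w, ψ₂.form (Z₂ v) w + ψ₂.form v (Z₂ w) = 0) → ι₂ ∘ₗ Z₂ ∘ₗ π₂ ∈ 𝔞 := by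
  classical
  have hsum' : ι₂ ∘ₗ π₂ + ι₁ ∘ₗ π₁ = LinearMap.id := by rw [add_comm]; exact hsum
  -- the corner maps as linear maps, rational and complex
  obtain ⟨cL₁, hcL₁⟩ : ∃ L : Module.End ℚ U →ₗ[ℚ] Module.End ℚ V₁, ∀ X, L X = π₁ ∘ₗ X ∘ₗ ι₁ :=
    ⟨{ toFun := fun X => π₁ ∘ₗ X ∘ₗ ι₁
       map_add' := fun X X' => by rw [LinearMap.add_comp, LinearMap.comp_add]
       map_smul' := fun c X => by rw [LinearMap.smul_comp, LinearMap.comp_smul, RingHom.id_apply] },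
      fun X => rfl⟩
  obtain ⟨cL₂, hcL₂⟩ : ∃ L : Module.End ℚ U →ₗ[ℚ] Module.End ℚ V₂, ∀ X, L X = π₂ ∘ₗ X ∘ₗ ι₂ :=
    ⟨{ toFun := fun X => π₂ ∘ₗ X ∘ₗ ι₂
       map_add' := fun X X' => by rw [LinearMap.add_comp, LinearMap.comp_add]
       map_smul' := fun c X => by rw [LinearMap.smul_comp, LinearMap.comp_smul, RingHom.id_apply] },
      fun X => rfl⟩
  obtain ⟨LC₁, hLC₁⟩ : ∃ L : Module.End ℂ (ℂ ⊗[ℚ] U) →ₗ[ℂ] Module.End ℂ (ℂ ⊗[ℚ] V₁),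
      ∀ T, L T = π₁.baseChange ℂ ∘ₗ T ∘ₗ ι₁.baseChange ℂ :=
    ⟨{ toFun := fun T => π₁.baseChange ℂ ∘ₗ T ∘ₗ ι₁.baseChange ℂ
       map_add' := fun T T' => by rw [LinearMap.add_comp, LinearMap.comp_add]
       map_smul' := fun c T => by rw [LinearMap.smul_comp, LinearMap.comp_smul, RingHom.id_apply] },
      fun T => rfl⟩
  obtain ⟨LC₂, hLC₂⟩ : ∃ L : Module.End ℂ (ℂ ⊗[ℚ] U) →ₗ[ℂ] Module.End ℂ (ℂ ⊗[ℚ] V₂),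
      ∀ T, L T = π₂.baseChange ℂ ∘ₗ T ∘ₗ ι₂.baseChange ℂ :=
    ⟨{ toFun := fun T => π₂.baseChange ℂ ∘ₗ T ∘ₗ ι₂.baseChange ℂ
       map_add' := fun T T' => by rw [LinearMap.add_comp, LinearMap.comp_add]
       map_smul' := fun c T => by rw [LinearMap.smul_comp, LinearMap.comp_smul, RingHom.id_apply] },
      fun T => rfl⟩
  have hLC₁c : ∀ X : Module.End ℚ U, LC₁ (X.baseChange ℂ) = (cL₁ X).baseChange ℂ := fun X => by
    rw [hLC₁, hcL₁, LinearMap.baseChange_comp, LinearMap.baseChange_comp]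
  have hLC₂c : ∀ X : Module.End ℚ U, LC₂ (X.baseChange ℂ) = (cL₂ X).baseChange ℂ := fun X => by
    rw [hLC₂, hcL₂, LinearMap.baseChange_comp, LinearMap.baseChange_comp]
  -- corners of brackets
  have hc₁br : ∀ X ∈ 𝔞, ∀ X' ∈ 𝔞, π₁ ∘ₗ (X * X' - X' * X) ∘ₗ ι₁ =
      (π₁ ∘ₗ X ∘ₗ ι₁) * (π₁ ∘ₗ X' ∘ₗ ι₁) - (π₁ ∘ₗ X' ∘ₗ ι₁) * (π₁ ∘ₗ X ∘ₗ ι₁) := fun X hX X' hX' =>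
    corner_bracket hπι₁ hπι₂ hπ₁ι₂ hsum (hP₁ X hX) (hP₂ X hX) (hP₁ X' hX') (hP₂ X' hX')
  have hc₂br : ∀ X ∈ 𝔞, ∀ X' ∈ 𝔞, π₂ ∘ₗ (X * X' - X' * X) ∘ₗ ι₂ =
      (π₂ ∘ₗ X ∘ₗ ι₂) * (π₂ ∘ₗ X' ∘ₗ ι₂) - (π₂ ∘ₗ X' ∘ₗ ι₂) * (π₂ ∘ₗ X ∘ₗ ι₂) := fun X hX X' hX' =>
    corner_bracket hπι₂ hπι₁ hπ₂ι₁ hsum' (hP₂ X hX) (hP₁ X hX) (hP₂ X' hX') (hP₁ X' hX')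
  -- the corner algebras `𝔤₁ = c₁(𝔞)`, `𝔤₂ = c₂(𝔞)`
  set 𝔤₁ : Submodule ℚ (Module.End ℚ V₁) := 𝔞.map cL₁ with h𝔤₁
  have h𝔤₁mem : ∀ {Y}, Y ∈ 𝔤₁ ↔ ∃ X ∈ 𝔞, π₁ ∘ₗ X ∘ₗ ι₁ = Y := by
    intro Y
    rw [h𝔤₁, Submodule.mem_map]
    simp only [hcL₁]
  have hbr𝔤₁ : ∀ Y ∈ 𝔤₁, ∀ Y' ∈ 𝔤₁, Y * Y' - Y' * Y ∈ 𝔤₁ := by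
    intro Y hY Y' hY'
    obtain ⟨X, hX, rfl⟩ := h𝔤₁mem.1 hY
    obtain ⟨X', hX', rfl⟩ := h𝔤₁mem.1 hY'
    exact h𝔤₁mem.2 ⟨_, hbr X hX X' hX', hc₁br X hX X' hX'⟩
  have hskew𝔤₁ : ∀ Y ∈ 𝔤₁, ∀ v w, ψ₁.form (Y v) w + ψ₁.form v (Y w) = 0 := by
    intro Y hY v w
    obtain ⟨X, hX, rfl⟩ := h𝔤₁mem.1 hY
    exact hskew₁ X hX v w
  set 𝔤₂ : Submodule ℚ (Module.End ℚ V₂) := 𝔞.map cL₂ with h𝔤₂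
  have h𝔤₂mem : ∀ {Y}, Y ∈ 𝔤₂ ↔ ∃ X ∈ 𝔞, π₂ ∘ₗ X ∘ₗ ι₂ = Y := by
    intro Y
    rw [h𝔤₂, Submodule.mem_map]
    simp only [hcL₂]
  have hbr𝔤₂ : ∀ Y ∈ 𝔤₂, ∀ Y' ∈ 𝔤₂, Y * Y' - Y' * Y ∈ 𝔤₂ := by
    intro Y hY Y' hY'
    obtain ⟨X, hX, rfl⟩ := h𝔤₂mem.1 hY
    obtain ⟨X', hX', rfl⟩ := h𝔤₂mem.1 hY'
    exact h𝔤₂mem.2 ⟨_, hbr X hX X' hX', hc₂br X hX X' hX'⟩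
  have hskew𝔤₂ : ∀ Y ∈ 𝔤₂, ∀ v w, ψ₂.form (Y v) w + ψ₂.form v (Y w) = 0 := by
    intro Y hY v w
    obtain ⟨X, hX, rfl⟩ := h𝔤₂mem.1 hY
    exact hskew₂ X hX v w
  -- `Θ_i = c_i(Θ_U) ∈ (𝔤_i)_ℂ`
  have hΘ₁eq : LC₁ ΘU = Θ₁ := by
    rw [hLC₁]
    apply LinearMap.ext
    intro x
    rw [LinearMap.comp_apply, LinearMap.comp_apply, hΘUι₁, proj_incl_baseChange hπι₁]
  have hΘ₂eq : LC₂ ΘU = Θ₂ := by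
    rw [hLC₂]
    apply LinearMap.ext
    intro x
    rw [LinearMap.comp_apply, LinearMap.comp_apply, hΘUι₂, proj_incl_baseChange hπι₂]
  have hΘ𝔤₁ : Θ₁ ∈ spanC 𝔤₁ := by rw [← hΘ₁eq]; exact map_mem_spanC_map cL₁ LC₁ hLC₁c 𝔞 hΘU𝔞
  have hΘ𝔤₂ : Θ₂ ∈ spanC 𝔤₂ := by rw [← hΘ₂eq]; exact map_mem_spanC_map cL₂ LC₂ hLC₂c 𝔞 hΘU𝔞
  -- (RIGID) and (IDEAL) for the rank-two factor
  have hrigid : ∀ 𝔤' : Submodule ℚ (Module.End ℚ V₂), (∀ X ∈ 𝔤', ∀ X' ∈ 𝔤', X * X' - X' * X ∈ 𝔤') →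
      (∀ X ∈ 𝔤', ∀ v w, ψ₂.form (X v) w + ψ₂.form v (X w) = 0) → Θ₂ ∈ spanC 𝔤' →
      ∀ Y : Module.End ℂ (ℂ ⊗[ℚ] V₂),
        (∀ x y, ψ₂.form.baseChange ℂ (Y x) y + ψ₂.form.baseChange ℂ x (Y y) = 0) → Y ∈ spanC 𝔤' :=
    fun 𝔤' hbr' hskew' hΘ' Y hY =>
      RankTwoTheta.mem_spanC_of_skew H₂ hn heff₂ ψ₂ hE₂ hV₂ 𝔤' hbr' hΘ₂ hΘ' hskew' hY
  have hfull₂ : ∀ Y : Module.End ℂ (ℂ ⊗[ℚ] V₂),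
      (∀ x y, ψ₂.form.baseChange ℂ (Y x) y + ψ₂.form.baseChange ℂ x (Y y) = 0) → Y ∈ spanC 𝔤₂ :=
    hrigid 𝔤₂ hbr𝔤₂ hskew𝔤₂ hΘ𝔤₂
  -- `Θ² = 1` on the blocks and on `U`
  have hΘΘ₁ : ∀ v, Θ₁ (Θ₁ v) = v := theta_theta_apply H₁ hn heff₁ hΘ₁
  have hΘΘ₂ : ∀ v, Θ₂ (Θ₂ v) = v := theta_theta_apply H₂ hn heff₂ hΘ₂
  have hΘΘUapp : ∀ y, ΘU (ΘU y) = y := by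
    intro y
    conv_lhs => rw [← incl_proj_add_baseChange hsum y]
    rw [map_add, map_add, hΘUι₁, hΘUι₁, hΘΘ₁, hΘUι₂, hΘUι₂, hΘΘ₂]
    exact incl_proj_add_baseChange hsum y
  have hΘΘU : ΘU * ΘU = 1 := LinearMap.ext fun y => hΘΘUapp y
  -- block calculus for elements of `𝔞_ℂ`
  have hPC₁ : ∀ T ∈ spanC 𝔞, T * (ι₁.baseChange ℂ ∘ₗ π₁.baseChange ℂ) = (ι₁.baseChange ℂ ∘ₗ π₁.baseChange ℂ) * T := by
    intro T hT
    have h := mul_baseChange_eq_of_mem_spanC hP₁ hT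
    rwa [LinearMap.baseChange_comp] at h
  have hPC₂ : ∀ T ∈ spanC 𝔞, T * (ι₂.baseChange ℂ ∘ₗ π₂.baseChange ℂ) = (ι₂.baseChange ℂ ∘ₗ π₂.baseChange ℂ) * T := by
    intro T hT
    have h := mul_baseChange_eq_of_mem_spanC hP₂ hT
    rwa [LinearMap.baseChange_comp] at h
  have happlyι₁ : ∀ T ∈ spanC 𝔞, ∀ v, T (ι₁.baseChange ℂ v) = ι₁.baseChange ℂ (LC₁ T v) := by
    intro T hT v
    have h := congrArg (fun S : Module.End ℂ (ℂ ⊗[ℚ] U) => S (ι₁.baseChange ℂ v)) (hPC₁ T hT)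
    simp only [Module.End.mul_apply, LinearMap.comp_apply, proj_incl_baseChange hπι₁] at h
    rw [hLC₁, LinearMap.comp_apply, LinearMap.comp_apply]
    exact h
  have happlyι₂ : ∀ T ∈ spanC 𝔞, ∀ v, T (ι₂.baseChange ℂ v) = ι₂.baseChange ℂ (LC₂ T v) := by
    intro T hT v
    have h := congrArg (fun S : Module.End ℂ (ℂ ⊗[ℚ] U) => S (ι₂.baseChange ℂ v)) (hPC₂ T hT)
    simp only [Module.End.mul_apply, LinearMap.comp_apply, proj_incl_baseChange hπι₂] at h
    rw [hLC₂, LinearMap.comp_apply, LinearMap.comp_apply]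
    exact h
  have hprojT₁ : ∀ T ∈ spanC 𝔞, ∀ y, π₁.baseChange ℂ (T y) = LC₁ T (π₁.baseChange ℂ y) := by
    intro T hT y
    conv_lhs => rw [← incl_proj_add_baseChange hsum y]
    rw [map_add, happlyι₁ T hT, happlyι₂ T hT, map_add, proj_incl_baseChange hπι₁,
      proj_incl_baseChange_eq_zero hπ₁ι₂, add_zero]
  have hprojT₂ : ∀ T ∈ spanC 𝔞, ∀ y, π₂.baseChange ℂ (T y) = LC₂ T (π₂.baseChange ℂ y) := by
    intro T hT y
    conv_lhs => rw [← incl_proj_add_baseChange hsum y]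
    rw [map_add, happlyι₁ T hT, happlyι₂ T hT, map_add, proj_incl_baseChange_eq_zero hπ₂ι₁,
      proj_incl_baseChange hπι₂, zero_add]
  have hLC₁mul : ∀ T T' : Module.End ℂ (ℂ ⊗[ℚ] U), T' ∈ spanC 𝔞 → LC₁ (T * T') = LC₁ T * LC₁ T' := by
    intro T T' hT'
    rw [hLC₁, hLC₁, hLC₁]
    exact cornerC_mul hπι₁ (hPC₁ T' hT')
  have hLC₂mul : ∀ T T' : Module.End ℂ (ℂ ⊗[ℚ] U), T' ∈ spanC 𝔞 → LC₂ (T * T') = LC₂ T * LC₂ T' := by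
    intro T T' hT'
    rw [hLC₂, hLC₂, hLC₂]
    exact cornerC_mul hπι₂ (hPC₂ T' hT')
  -- the kernel `K = 𝔞 ∩ ker c₁`
  set K : Submodule ℚ (Module.End ℚ U) := 𝔞 ⊓ LinearMap.ker cL₁ with hK
  have hKmem : ∀ {X}, X ∈ K ↔ X ∈ 𝔞 ∧ π₁ ∘ₗ X ∘ₗ ι₁ = 0 := by
    intro X
    rw [hK, Submodule.mem_inf, LinearMap.mem_ker, hcL₁]
  have hKideal : ∀ X' ∈ 𝔞, ∀ X ∈ K, X' * X - X * X' ∈ K := by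
    intro X' hX' X hX
    obtain ⟨hX𝔞, hc₁X⟩ := hKmem.1 hX
    refine hKmem.2 ⟨hbr X' hX' X hX𝔞, ?_⟩
    rw [hc₁br X' hX' X hX𝔞, hc₁X, mul_zero, zero_mul, sub_zero]
  -- THE NEW STEP: `K ≠ 0`, the graph case being excluded by `Hom = 0`
  have hK0 : K ≠ ⊥ := by
    intro hKbot
    have hinj : ∀ X ∈ 𝔞, cL₁ X = 0 → X = 0 := fun X hX h0 => by
      have hXK : X ∈ K := hKmem.2 ⟨hX, by rw [← hcL₁]; exact h0⟩
      rw [hKbot] at hXK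
      exact (Submodule.mem_bot ℚ).1 hXK
    have hinjC : ∀ T ∈ spanC 𝔞, LC₁ T = 0 → T = 0 := fun T hT hT0 =>
      eq_zero_of_map_eq_zero_of_mem_spanC cL₁ LC₁ hLC₁c 𝔞 hinj hT hT0
    -- `𝔞₀ = 𝔞 ∩ ker c₂` and the ideal `𝔨₁ = c₁(𝔞₀)` of `𝔤₁`
    set 𝔞₀ : Submodule ℚ (Module.End ℚ U) := 𝔞 ⊓ LinearMap.ker cL₂ with h𝔞₀
    have h𝔞₀mem : ∀ {X}, X ∈ 𝔞₀ ↔ X ∈ 𝔞 ∧ π₂ ∘ₗ X ∘ₗ ι₂ = 0 := by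
      intro X
      rw [h𝔞₀, Submodule.mem_inf, LinearMap.mem_ker, hcL₂]
    have h𝔞₀ideal : ∀ X' ∈ 𝔞, ∀ X ∈ 𝔞₀, X' * X - X * X' ∈ 𝔞₀ := by
      intro X' hX' X hX
      obtain ⟨hX𝔞, hc₂X⟩ := h𝔞₀mem.1 hX
      refine h𝔞₀mem.2 ⟨hbr X' hX' X hX𝔞, ?_⟩
      rw [hc₂br X' hX' X hX𝔞, hc₂X, mul_zero, zero_mul, sub_zero]
    set 𝔨₁ : Submodule ℚ (Module.End ℚ V₁) := 𝔞₀.map cL₁ with h𝔨₁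
    have h𝔨₁mem : ∀ {Y}, Y ∈ 𝔨₁ ↔ ∃ X ∈ 𝔞₀, π₁ ∘ₗ X ∘ₗ ι₁ = Y := by
      intro Y
      rw [h𝔨₁, Submodule.mem_map]
      simp only [hcL₁]
    have h𝔨₁le : 𝔨₁ ≤ 𝔤₁ := Submodule.map_mono inf_le_left
    have h𝔨₁ideal : ∀ Y ∈ 𝔤₁, ∀ Y' ∈ 𝔨₁, Y * Y' - Y' * Y ∈ 𝔨₁ := by
      intro Y hY Y' hY'
      obtain ⟨X, hX, rfl⟩ := h𝔤₁mem.1 hY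
      obtain ⟨X', hX', rfl⟩ := h𝔨₁mem.1 hY'
      exact h𝔨₁mem.2 ⟨_, h𝔞₀ideal X hX X' hX', hc₁br X hX X' (h𝔞₀mem.1 hX').1⟩
    -- the complementary ideal `𝔤₃` and `𝔞₃ = 𝔞 ∩ c₁⁻¹(𝔤₃)`
    obtain ⟨𝔤₃, -, h𝔤₃ideal, h𝔨𝔤₃inf, h𝔨𝔤₃sup⟩ :=
      exists_ideal_compl H₁ hn heff₁ ψ₁ 𝔤₁ hbr𝔤₁ hΘ₁ hΘ𝔤₁ hskew𝔤₁ h𝔨₁le h𝔨₁ideal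
    set 𝔞₃ : Submodule ℚ (Module.End ℚ U) := 𝔞 ⊓ 𝔤₃.comap cL₁ with h𝔞₃
    have h𝔞₃mem : ∀ {X}, X ∈ 𝔞₃ ↔ X ∈ 𝔞 ∧ π₁ ∘ₗ X ∘ₗ ι₁ ∈ 𝔤₃ := by
      intro X
      rw [h𝔞₃, Submodule.mem_inf, Submodule.mem_comap, hcL₁]
    have h𝔞₃le : 𝔞₃ ≤ 𝔞 := inf_le_left
    have h𝔞₃leC : spanC 𝔞₃ ≤ spanC 𝔞 := spanC_mono h𝔞₃le
    have h𝔞₃ideal : ∀ X' ∈ 𝔞, ∀ X ∈ 𝔞₃, X' * X - X * X' ∈ 𝔞₃ := by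
      intro X' hX' X hX
      obtain ⟨hX𝔞, hc₁X⟩ := h𝔞₃mem.1 hX
      refine h𝔞₃mem.2 ⟨hbr X' hX' X hX𝔞, ?_⟩
      rw [hc₁br X' hX' X hX𝔞]
      exact h𝔤₃ideal _ (h𝔤₁mem.2 ⟨X', hX', rfl⟩) _ hc₁X
    have hbr𝔞₃ : ∀ X ∈ 𝔞₃, ∀ X' ∈ 𝔞₃, X * X' - X' * X ∈ 𝔞₃ := fun X hX X' hX' =>
      h𝔞₃ideal X (h𝔞₃le hX) X' hX'
    -- `c₂` is injective on `𝔞₃` (`𝔨₁ ∩ 𝔤₃ = 0`, `c₁` injective) and on `(𝔞₃)_ℂ`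
    have h𝔞₃inj : ∀ X ∈ 𝔞₃, cL₂ X = 0 → X = 0 := by
      intro X hX h0
      obtain ⟨hX𝔞, hc₁X⟩ := h𝔞₃mem.1 hX
      have hX0 : X ∈ 𝔞₀ := h𝔞₀mem.2 ⟨hX𝔞, by rw [← hcL₂]; exact h0⟩
      have hzero : π₁ ∘ₗ X ∘ₗ ι₁ ∈ 𝔨₁ ⊓ 𝔤₃ := Submodule.mem_inf.2 ⟨h𝔨₁mem.2 ⟨X, hX0, rfl⟩, hc₁X⟩
      rw [h𝔨𝔤₃inf, Submodule.mem_bot] at hzero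
      exact hinj X hX𝔞 (by rw [hcL₁]; exact hzero)
    have h𝔞₃injC : ∀ T ∈ spanC 𝔞₃, LC₂ T = 0 → T = 0 := fun T hT hT0 =>
      eq_zero_of_map_eq_zero_of_mem_spanC cL₂ LC₂ hLC₂c 𝔞₃ h𝔞₃inj hT hT0
    -- `𝔞 ⊆ 𝔞₀ + 𝔞₃`, so `c₂(𝔞) ⊆ c₂(𝔞₃)` and (RIGID) holds for `c₂(𝔞₃)`
    have h𝔞le : 𝔞 ≤ 𝔞₀ ⊔ 𝔞₃ := by
      intro X hX
      have hc₁ : π₁ ∘ₗ X ∘ₗ ι₁ ∈ 𝔨₁ ⊔ 𝔤₃ := by rw [h𝔨𝔤₃sup]; exact h𝔤₁mem.2 ⟨X, hX, rfl⟩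
      obtain ⟨k, hk, g, hg, hkg⟩ := Submodule.mem_sup.1 hc₁
      obtain ⟨X₀, hX₀, rfl⟩ := h𝔨₁mem.1 hk
      have hX₀𝔞 : X₀ ∈ 𝔞 := (h𝔞₀mem.1 hX₀).1
      refine Submodule.mem_sup.2 ⟨X₀, hX₀, X - X₀, h𝔞₃mem.2 ⟨Submodule.sub_mem _ hX hX₀𝔞, ?_⟩, by abel⟩
      have e : π₁ ∘ₗ (X - X₀) ∘ₗ ι₁ = g := by
        rw [LinearMap.sub_comp, LinearMap.comp_sub, ← hkg]
        abel
      rw [e]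
      exact hg
    set 𝔤₂₃ : Submodule ℚ (Module.End ℚ V₂) := 𝔞₃.map cL₂ with h𝔤₂₃
    have h𝔤₂₃mem : ∀ {Y}, Y ∈ 𝔤₂₃ ↔ ∃ X ∈ 𝔞₃, π₂ ∘ₗ X ∘ₗ ι₂ = Y := by
      intro Y
      rw [h𝔤₂₃, Submodule.mem_map]
      simp only [hcL₂]
    have h𝔤₂le : 𝔤₂ ≤ 𝔤₂₃ := by
      intro Y hY
      obtain ⟨X, hX, rfl⟩ := h𝔤₂mem.1 hY
      obtain ⟨X₀, hX₀, X₃, hX₃, rfl⟩ := Submodule.mem_sup.1 (h𝔞le hX)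
      refine h𝔤₂₃mem.2 ⟨X₃, hX₃, ?_⟩
      rw [LinearMap.add_comp, LinearMap.comp_add, (h𝔞₀mem.1 hX₀).2, zero_add]
    have hbr𝔤₂₃ : ∀ Y ∈ 𝔤₂₃, ∀ Y' ∈ 𝔤₂₃, Y * Y' - Y' * Y ∈ 𝔤₂₃ := by
      intro Y hY Y' hY'
      obtain ⟨X, hX, rfl⟩ := h𝔤₂₃mem.1 hY
      obtain ⟨X', hX', rfl⟩ := h𝔤₂₃mem.1 hY'
      exact h𝔤₂₃mem.2 ⟨_, hbr𝔞₃ X hX X' hX', hc₂br X (h𝔞₃le hX) X' (h𝔞₃le hX')⟩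
    have hskew𝔤₂₃ : ∀ Y ∈ 𝔤₂₃, ∀ v w, ψ₂.form (Y v) w + ψ₂.form v (Y w) = 0 := by
      intro Y hY v w
      obtain ⟨X, hX, rfl⟩ := h𝔤₂₃mem.1 hY
      exact hskew₂ X (h𝔞₃le hX) v w
    have hΘ𝔤₂₃ : Θ₂ ∈ spanC 𝔤₂₃ := spanC_mono h𝔤₂le hΘ𝔤₂
    have hfull₃ : ∀ Y : Module.End ℂ (ℂ ⊗[ℚ] V₂),
        (∀ x y, ψ₂.form.baseChange ℂ (Y x) y + ψ₂.form.baseChange ℂ x (Y y) = 0) → Y ∈ spanC 𝔤₂₃ :=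
      hrigid 𝔤₂₃ hbr𝔤₂₃ hskew𝔤₂₃ hΘ𝔤₂₃
    have hskewC₃ : ∀ T ∈ spanC 𝔞₃, ∀ x y,
        ψ₂.form.baseChange ℂ (LC₂ T x) y + ψ₂.form.baseChange ℂ x (LC₂ T y) = 0 := fun T hT =>
      ThetaSubalgebra.formBaseChange_add_eq_zero_of_mem_spanC ψ₂ hskew𝔤₂₃ (map_mem_spanC_map cL₂ LC₂ hLC₂c 𝔞₃ hT)
    -- the Hodge basis `(v₊, v₋)` of `V₂ ⊗ ℂ` and `𝔰𝔩₂ = ⟨e₂, f₂, Θ₂⟩`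
    obtain ⟨b, hb0, hb1⟩ := RankTwoTheta.exists_basis H₂ hn heff₂ hV₂ hΘ₂
    obtain ⟨-, -, hΘ10, hΘ01, -⟩ := UnitaryTheta.theta_facts H₂ hn heff₂ hΘ₂
    have hΘb0 : Θ₂ (b 0) = b 0 := hΘ10 _ hb0
    have hΘb1 : Θ₂ (b 1) = -b 1 := hΘ01 _ hb1
    obtain ⟨heskew, hfskew⟩ := RankTwoTheta.constr_skew H₂ hn ψ₂ b
    obtain ⟨e₂, he₂⟩ : ∃ e : Module.End ℂ (ℂ ⊗[ℚ] V₂), e = b.constr ℂ ![(0 : ℂ ⊗[ℚ] V₂), b 0] := ⟨_, rfl⟩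
    obtain ⟨f₂, hf₂⟩ : ∃ f : Module.End ℂ (ℂ ⊗[ℚ] V₂), f = b.constr ℂ ![b 1, (0 : ℂ ⊗[ℚ] V₂)] := ⟨_, rfl⟩
    rw [← he₂] at heskew
    rw [← hf₂] at hfskew
    have he0 : e₂ (b 0) = 0 := by rw [he₂]; simp
    have he1 : e₂ (b 1) = b 0 := by rw [he₂]; simp
    have hf0 : f₂ (b 0) = b 1 := by rw [hf₂]; simp
    have hf1 : f₂ (b 1) = 0 := by rw [hf₂]; simp
    have hΘe : Θ₂ * e₂ = e₂ := b.ext fun j => by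
      fin_cases j <;> simp [he0, he1, hΘb0]
    have heΘ : e₂ * Θ₂ = -e₂ := b.ext fun j => by
      fin_cases j <;> simp [he0, he1, hΘb0, hΘb1]
    have hΘf : Θ₂ * f₂ = -f₂ := b.ext fun j => by
      fin_cases j <;> simp [hf0, hf1, hΘb1]
    have hfΘ : f₂ * Θ₂ = f₂ := b.ext fun j => by
      fin_cases j <;> simp [hf0, hf1, hΘb0, hΘb1]
    have hef : e₂ * f₂ - f₂ * e₂ = Θ₂ := b.ext fun j => by
      fin_cases j <;> simp [he0, he1, hf0, hf1, hΘb0, hΘb1]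
    -- lifts of `e₂`, `f₂` in `(𝔞₃)_ℂ`, symmetrised by `Ad(Θ_U)`
    obtain ⟨Xe, hXe, hXe₂⟩ := exists_mem_spanC_map_eq cL₂ LC₂ hLC₂c 𝔞₃ (hfull₃ e₂ heskew)
    obtain ⟨Xf, hXf, hXf₂⟩ := exists_mem_spanC_map_eq cL₂ LC₂ hLC₂c 𝔞₃ (hfull₃ f₂ hfskew)
    have hsymm : ∀ X : Module.End ℂ (ℂ ⊗[ℚ] U),
        ΘU * (X - ΘU * X * ΘU + (ΘU * X - X * ΘU)) = X - ΘU * X * ΘU + (ΘU * X - X * ΘU) ∧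
        (X - ΘU * X * ΘU + (ΘU * X - X * ΘU)) * ΘU = -(X - ΘU * X * ΘU + (ΘU * X - X * ΘU)) ∧
        ΘU * (X - ΘU * X * ΘU - (ΘU * X - X * ΘU)) = -(X - ΘU * X * ΘU - (ΘU * X - X * ΘU)) ∧
        (X - ΘU * X * ΘU - (ΘU * X - X * ΘU)) * ΘU = X - ΘU * X * ΘU - (ΘU * X - X * ΘU) := by
      intro X
      refine ⟨?_, ?_, ?_, ?_⟩ <;>
      · apply LinearMap.ext
        intro y
        simp only [Module.End.mul_apply, LinearMap.sub_apply, LinearMap.add_apply, LinearMap.neg_apply,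
          map_sub, map_add, hΘΘUapp]
        abel
    have hstab : ∀ X ∈ spanC 𝔞₃, X - ΘU * X * ΘU + (ΘU * X - X * ΘU) ∈ spanC 𝔞₃ ∧
        X - ΘU * X * ΘU - (ΘU * X - X * ΘU) ∈ spanC 𝔞₃ := by
      intro X hX
      have h1 : ΘU * X * ΘU ∈ spanC 𝔞₃ := theta_mul_mul_theta_mem_spanC_of_ideal h𝔞₃ideal hΘU𝔞 hΘΘU hX
      have h2 : ΘU * X - X * ΘU ∈ spanC 𝔞₃ := bracket_mem_spanC_of_forall h𝔞₃ideal hΘU𝔞 hX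
      exact ⟨Submodule.add_mem _ (Submodule.sub_mem _ hX h1) h2, Submodule.sub_mem _ (Submodule.sub_mem _ hX h1) h2⟩
    obtain ⟨Xe', hXe'⟩ : ∃ X : Module.End ℂ (ℂ ⊗[ℚ] U),
        X = (4 : ℂ)⁻¹ • (Xe - ΘU * Xe * ΘU + (ΘU * Xe - Xe * ΘU)) := ⟨_, rfl⟩
    obtain ⟨Xf', hXf'⟩ : ∃ X : Module.End ℂ (ℂ ⊗[ℚ] U),
        X = (4 : ℂ)⁻¹ • (Xf - ΘU * Xf * ΘU - (ΘU * Xf - Xf * ΘU)) := ⟨_, rfl⟩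
    have hXe'₃ : Xe' ∈ spanC 𝔞₃ := by rw [hXe']; exact Submodule.smul_mem _ _ (hstab Xe hXe).1
    have hXf'₃ : Xf' ∈ spanC 𝔞₃ := by rw [hXf']; exact Submodule.smul_mem _ _ (hstab Xf hXf).2
    have hXe'𝔞 : Xe' ∈ spanC 𝔞 := h𝔞₃leC hXe'₃
    have hXf'𝔞 : Xf' ∈ spanC 𝔞 := h𝔞₃leC hXf'₃
    have hΘXe' : ΘU * Xe' = Xe' := by rw [hXe', mul_smul_comm, (hsymm Xe).1]
    have hXe'Θ : Xe' * ΘU = -Xe' := by rw [hXe', smul_mul_assoc, (hsymm Xe).2.1, smul_neg]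
    have hΘXf' : ΘU * Xf' = -Xf' := by rw [hXf', mul_smul_comm, (hsymm Xf).2.2.1, smul_neg]
    have hXf'Θ : Xf' * ΘU = Xf' := by rw [hXf', smul_mul_assoc, (hsymm Xf).2.2.2]
    -- their second corners are `e₂`, `f₂`
    have hLC₂Xe' : LC₂ Xe' = e₂ := by
      rw [hXe', map_smul, map_add, map_sub, map_sub, hLC₂mul _ _ hΘU𝔞, hLC₂mul _ _ (h𝔞₃leC hXe),
        hLC₂mul _ _ hΘU𝔞, hΘ₂eq, hXe₂, hΘe, heΘ]
      module
    have hLC₂Xf' : LC₂ Xf' = f₂ := by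
      rw [hXf', map_smul, map_sub, map_sub, map_sub, hLC₂mul _ _ hΘU𝔞, hLC₂mul _ _ (h𝔞₃leC hXf),
        hLC₂mul _ _ hΘU𝔞, hΘ₂eq, hXf₂, mul_assoc Θ₂ f₂ Θ₂, hfΘ, hΘf]
      module
    -- `(𝔞₃)_ℂ = ⟨Xe', Xf', [Xe', Xf']⟩`
    obtain ⟨G, hG⟩ : ∃ G : Module.End ℂ (ℂ ⊗[ℚ] U), G = Xe' * Xf' - Xf' * Xe' := ⟨_, rfl⟩
    have hG₃ : G ∈ spanC 𝔞₃ := by rw [hG]; exact bracket_mem_spanC_of_forall hbr𝔞₃ hXe'₃ hXf'₃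
    have hLC₂G : LC₂ G = Θ₂ := by
      rw [hG, map_sub, hLC₂mul _ _ hXf'𝔞, hLC₂mul _ _ hXe'𝔞, hLC₂Xe', hLC₂Xf', hef]
    have hdec₃ : ∀ T ∈ spanC 𝔞₃, T = LinearMap.toMatrix b b (LC₂ T) 0 1 • Xe' +
        LinearMap.toMatrix b b (LC₂ T) 1 0 • Xf' + LinearMap.toMatrix b b (LC₂ T) 0 0 • G := by
      intro T hT
      have hskT := hskewC₃ T hT
      have hY := RankTwoTheta.eq_of_skew H₂ hn heff₂ ψ₂ b hb0 hb1 hΘ₂ hskT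
      rw [← he₂, ← hf₂] at hY
      have hD : T - (LinearMap.toMatrix b b (LC₂ T) 0 1 • Xe' + LinearMap.toMatrix b b (LC₂ T) 1 0 • Xf' +
          LinearMap.toMatrix b b (LC₂ T) 0 0 • G) ∈ spanC 𝔞₃ :=
        Submodule.sub_mem _ hT (Submodule.add_mem _ (Submodule.add_mem _ (Submodule.smul_mem _ _ hXe'₃)
          (Submodule.smul_mem _ _ hXf'₃)) (Submodule.smul_mem _ _ hG₃))
      have h0 := h𝔞₃injC _ hD (by
        rw [map_sub, map_add, map_add, map_smul, map_smul, map_smul, hLC₂Xe', hLC₂Xf', hLC₂G, ← hY, sub_self])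
      exact sub_eq_zero.1 h0
    -- first corners `E`, `F`, `G₁`
    obtain ⟨E, hE⟩ : ∃ E : Module.End ℂ (ℂ ⊗[ℚ] V₁), E = LC₁ Xe' := ⟨_, rfl⟩
    obtain ⟨F, hF⟩ : ∃ F : Module.End ℂ (ℂ ⊗[ℚ] V₁), F = LC₁ Xf' := ⟨_, rfl⟩
    have hΘE : Θ₁ * E = E := by rw [hE, ← hΘ₁eq, ← hLC₁mul _ _ hXe'𝔞, hΘXe']
    have hEΘ : E * Θ₁ = -E := by rw [hE, ← hΘ₁eq, ← hLC₁mul _ _ hΘU𝔞, hXe'Θ, map_neg]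
    have hΘF : Θ₁ * F = -F := by rw [hF, ← hΘ₁eq, ← hLC₁mul _ _ hXf'𝔞, hΘXf', map_neg]
    have hFΘ : F * Θ₁ = F := by rw [hF, ← hΘ₁eq, ← hLC₁mul _ _ hΘU𝔞, hXf'Θ]
    have hsq : ∀ A : Module.End ℂ (ℂ ⊗[ℚ] V₁), Θ₁ * A = A → A * Θ₁ = -A → A * A = 0 := by
      intro A h1 h2
      have h : (A * Θ₁ + A) * A = 0 := by rw [h2, neg_add_cancel, zero_mul]
      rw [add_mul, mul_assoc, h1, ← two_smul ℂ] at h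
      exact (smul_eq_zero.1 h).resolve_left two_ne_zero
    have hsq' : ∀ A : Module.End ℂ (ℂ ⊗[ℚ] V₁), Θ₁ * A = -A → A * Θ₁ = A → A * A = 0 := by
      intro A h1 h2
      have h : A * (Θ₁ * A + A) = 0 := by rw [h1, neg_add_cancel, mul_zero]
      rw [mul_add, ← mul_assoc, h2, ← two_smul ℂ] at h
      exact (smul_eq_zero.1 h).resolve_left two_ne_zero
    have hEE : E * E = 0 := hsq E hΘE hEΘ
    have hFF : F * F = 0 := hsq' F hΘF hFΘ
    -- `[[Xe', Xf'], Xe'] = 2 Xe'` (transported from `𝔰𝔩₂` by `c₂`-injectivity), hence `EFE = E`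
    have hGXe : G * Xe' - Xe' * G = (2 : ℂ) • Xe' := by
      have hD : G * Xe' - Xe' * G - (2 : ℂ) • Xe' ∈ spanC 𝔞₃ :=
        Submodule.sub_mem _ (bracket_mem_spanC_of_forall hbr𝔞₃ hG₃ hXe'₃) (Submodule.smul_mem _ _ hXe'₃)
      have h0 := h𝔞₃injC _ hD (by
        rw [map_sub, map_sub, map_smul, hLC₂mul _ _ hXe'𝔞, hLC₂mul _ _ (h𝔞₃leC hG₃), hLC₂G, hLC₂Xe', hΘe, heΘ,
          two_smul]
        abel)
      exact sub_eq_zero.1 h0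
    have hEFE : E * F * E = E := by
      have h := congrArg LC₁ hGXe
      rw [map_sub, map_smul, hLC₁mul _ _ hXe'𝔞, hLC₁mul _ _ (h𝔞₃leC hG₃), hG, map_sub, hLC₁mul _ _ hXf'𝔞,
        hLC₁mul _ _ hXe'𝔞, ← hE, ← hF] at h
      have h' : (2 : ℂ) • (E * F * E) = (2 : ℂ) • E := by
        rw [← h, two_smul, sub_mul, mul_sub, mul_assoc F E E, hEE, mul_zero, sub_zero, ← mul_assoc, hEE, zero_mul,
          zero_sub, sub_neg_eq_add, mul_assoc]
      exact smul_right_injective _ (two_ne_zero (α := ℂ)) h'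
    -- `E ≠ 0` (`c₁` is injective on `𝔞_ℂ`)
    have hE0 : E ≠ 0 := by
      intro hE0
      have hXe'0 : Xe' = 0 := hinjC Xe' hXe'𝔞 (by rw [← hE]; exact hE0)
      have he₂0 : e₂ = 0 := by rw [← hLC₂Xe', hXe'0, map_zero]
      have : b 0 = 0 := by rw [← he1, he₂0, LinearMap.zero_apply]
      exact b.ne_zero 0 this
    obtain ⟨u, hu⟩ : ∃ u, E u ≠ 0 := by
      by_contra h
      push Not at h
      exact hE0 (LinearMap.ext h)
    -- the witness `Z' = ι₁ ∘ (v₊ ↦ Eu, v₋ ↦ FEu) ∘ π₂` commutes with `(𝔞₃)_ℂ`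
    obtain ⟨w, hw⟩ : ∃ w : ℂ ⊗[ℚ] V₁, w = E u := ⟨_, rfl⟩
    obtain ⟨Fm, hFm⟩ : ∃ Fm : ℂ ⊗[ℚ] V₂ →ₗ[ℂ] ℂ ⊗[ℚ] V₁, Fm = b.constr ℂ ![w, F w] := ⟨_, rfl⟩
    have hFm0 : Fm (b 0) = w := by rw [hFm]; simp
    have hFm1 : Fm (b 1) = F w := by rw [hFm]; simp
    have hEw : E w = 0 := by rw [hw, ← Module.End.mul_apply, hEE, LinearMap.zero_apply]
    have hEFw : E (F w) = w := by rw [hw, ← Module.End.mul_apply, ← Module.End.mul_apply, hEFE]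
    have hFFw : F (F w) = 0 := by rw [← Module.End.mul_apply, hFF, LinearMap.zero_apply]
    have hEFm : E ∘ₗ Fm = Fm ∘ₗ e₂ := b.ext fun j => by
      fin_cases j <;> simp [hFm0, hFm1, he0, he1, hEw, hEFw]
    have hFFm : F ∘ₗ Fm = Fm ∘ₗ f₂ := b.ext fun j => by
      fin_cases j <;> simp [hFm0, hFm1, hf0, hf1, hFFw]
    obtain ⟨Z', hZ'⟩ : ∃ Z' : Module.End ℂ (ℂ ⊗[ℚ] U), Z' = ι₁.baseChange ℂ ∘ₗ Fm ∘ₗ π₂.baseChange ℂ :=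
      ⟨_, rfl⟩
    have hcommZ' : ∀ T ∈ spanC 𝔞, LC₁ T ∘ₗ Fm = Fm ∘ₗ LC₂ T → T * Z' = Z' * T := by
      intro T hT hTF
      apply LinearMap.ext
      intro y
      rw [Module.End.mul_apply, Module.End.mul_apply, hZ', LinearMap.comp_apply, LinearMap.comp_apply,
        happlyι₁ T hT, LinearMap.comp_apply, LinearMap.comp_apply, hprojT₂ T hT, ← LinearMap.comp_apply (f := LC₁ T),
        hTF, LinearMap.comp_apply]
    have hcE : Xe' * Z' = Z' * Xe' := hcommZ' Xe' hXe'𝔞 (by rw [← hE, hLC₂Xe']; exact hEFm)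
    have hcF : Xf' * Z' = Z' * Xf' := hcommZ' Xf' hXf'𝔞 (by rw [← hF, hLC₂Xf']; exact hFFm)
    have hcG : G * Z' = Z' * G := by
      have h1 : Xe' * Xf' * Z' = Z' * (Xe' * Xf') := by rw [mul_assoc, hcF, ← mul_assoc, hcE, mul_assoc]
      have h2 : Xf' * Xe' * Z' = Z' * (Xf' * Xe') := by rw [mul_assoc, hcE, ← mul_assoc, hcF, mul_assoc]
      rw [hG, sub_mul, mul_sub, h1, h2]
    have hcomm₃ : ∀ T ∈ spanC 𝔞₃, T * Z' = Z' * T := by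
      intro T hT
      rw [hdec₃ T hT]
      simp only [add_mul, mul_add, smul_mul_assoc, mul_smul_comm, hcE, hcF, hcG]
    -- descent: `Z'` lies in the complex span of the RATIONAL operators commuting with `𝔞₃` ...
    have hZ'span := mem_span_baseChange_of_forall_commute (𝔞₃ : Set (Module.End ℚ U)) (Y := Z')
      (fun X hX => (hcomm₃ _ (baseChange_mem_spanC hX)).symm)
    -- ... whose `(1,2)`-blocks vanish by `Hom = 0`
    have hblock : ∀ Z : Module.End ℚ U, (∀ X ∈ (𝔞₃ : Set (Module.End ℚ U)), Z * X = X * Z) →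
        π₁ ∘ₗ Z ∘ₗ ι₂ = 0 := by
      intro Z hZ
      have hZC : ∀ T ∈ spanC 𝔞₃, T * Z.baseChange ℂ = Z.baseChange ℂ * T := fun T hT =>
        (commute_of_mem_spanC (𝔤 := 𝔞₃) (T := Z.baseChange ℂ) (fun X hX => by
          rw [← LinearMap.baseChange_mul, hZ X hX, LinearMap.baseChange_mul]) hT).symm
      -- `f_ℂ e₂ = E f_ℂ` and `f_ℂ f₂ = F f_ℂ` for `f = π₁ Z ι₂`
      have hfT : ∀ T ∈ spanC 𝔞₃, ∀ x, (π₁ ∘ₗ Z ∘ₗ ι₂).baseChange ℂ (LC₂ T x) =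
          LC₁ T ((π₁ ∘ₗ Z ∘ₗ ι₂).baseChange ℂ x) := by
        intro T hT x
        have hT𝔞 : T ∈ spanC 𝔞 := h𝔞₃leC hT
        rw [LinearMap.baseChange_comp, LinearMap.baseChange_comp, LinearMap.comp_apply, LinearMap.comp_apply,
          LinearMap.comp_apply, LinearMap.comp_apply, ← happlyι₂ T hT𝔞, ← Module.End.mul_apply (f := Z.baseChange ℂ),
          ← hZC T hT, Module.End.mul_apply, hprojT₁ T hT𝔞]
      refine hHom _ (b.ext fun j => ?_)
      fin_cases j
      · change Θ₁ ((π₁ ∘ₗ Z ∘ₗ ι₂).baseChange ℂ (b 0)) = (π₁ ∘ₗ Z ∘ₗ ι₂).baseChange ℂ (Θ₂ (b 0))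
        have h := hfT Xe' hXe'₃ (b 1)
        rw [hLC₂Xe', he1] at h
        rw [hΘb0, h, ← Module.End.mul_apply (f := Θ₁), ← hE, hΘE]
      · change Θ₁ ((π₁ ∘ₗ Z ∘ₗ ι₂).baseChange ℂ (b 1)) = (π₁ ∘ₗ Z ∘ₗ ι₂).baseChange ℂ (Θ₂ (b 1))
        have h := hfT Xf' hXf'₃ (b 0)
        rw [hLC₂Xf', hf0] at h
        rw [hΘb1, map_neg, h, ← Module.End.mul_apply (f := Θ₁), ← hF, hΘF, LinearMap.neg_apply]
    -- hence the `(1,2)`-block `Fm` of `Z'` vanishes: contradiction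
    obtain ⟨Φ, hΦ⟩ : ∃ L : Module.End ℂ (ℂ ⊗[ℚ] U) →ₗ[ℂ] (ℂ ⊗[ℚ] V₂ →ₗ[ℂ] ℂ ⊗[ℚ] V₁),
        ∀ T, L T = π₁.baseChange ℂ ∘ₗ T ∘ₗ ι₂.baseChange ℂ :=
      ⟨{ toFun := fun T => π₁.baseChange ℂ ∘ₗ T ∘ₗ ι₂.baseChange ℂ
         map_add' := fun T T' => by rw [LinearMap.add_comp, LinearMap.comp_add]
         map_smul' := fun c T => by rw [LinearMap.smul_comp, LinearMap.comp_smul, RingHom.id_apply] },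
        fun T => rfl⟩
    have hΦspan : ∀ T ∈ Submodule.span ℂ ((fun Z : Module.End ℚ U => Z.baseChange ℂ) ''
        {Z | ∀ X ∈ (𝔞₃ : Set (Module.End ℚ U)), Z * X = X * Z}), Φ T = 0 := by
      intro T hT
      induction hT using Submodule.span_induction with
      | mem T' hT' =>
        obtain ⟨Z, hZ, rfl⟩ := hT'
        rw [hΦ, ← LinearMap.baseChange_comp, ← LinearMap.baseChange_comp, hblock Z hZ, LinearMap.baseChange_zero]
      | zero => rw [map_zero]
      | add T' T'' _ _ h' h'' => rw [map_add, h', h'', add_zero]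
      | smul c T' _ h' => rw [map_smul, h', smul_zero]
    have hFm0' : Fm = 0 := by
      have h := hΦspan Z' hZ'span
      rw [hΦ, hZ'] at h
      have h' : π₁.baseChange ℂ ∘ₗ (ι₁.baseChange ℂ ∘ₗ Fm ∘ₗ π₂.baseChange ℂ) ∘ₗ ι₂.baseChange ℂ = Fm := by
        apply LinearMap.ext
        intro x
        simp only [LinearMap.comp_apply, proj_incl_baseChange hπι₁, proj_incl_baseChange hπι₂]
      rw [h'] at h
      exact h
    apply hu
    rw [← hw, ← hFm0, hFm0', LinearMap.zero_apply]
  -- FROM HERE ON: the tree's Goursat argument (`goursat_incl_corner_mem`) verbatim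
  obtain ⟨X₀, hX₀K, hX₀ne⟩ := (Submodule.ne_bot_iff K).1 hK0
  set 𝔤K : Submodule ℚ (Module.End ℚ V₂) := K.map cL₂ with h𝔤K
  have h𝔤Kmem : ∀ {Y}, Y ∈ 𝔤K ↔ ∃ X ∈ K, π₂ ∘ₗ X ∘ₗ ι₂ = Y := by
    intro Y
    rw [h𝔤K, Submodule.mem_map]
    simp only [hcL₂]
  have h𝔤Kle : 𝔤K ≤ 𝔤₂ := Submodule.map_mono inf_le_left
  have hideal𝔤K : ∀ Y ∈ 𝔤₂, ∀ Y' ∈ 𝔤K, Y * Y' - Y' * Y ∈ 𝔤K := by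
    intro Y hY Y' hY'
    obtain ⟨X, hX, rfl⟩ := h𝔤₂mem.1 hY
    obtain ⟨X', hX', rfl⟩ := h𝔤Kmem.1 hY'
    exact h𝔤Kmem.2 ⟨_, hKideal X hX X' hX', hc₂br X hX X' (hKmem.1 hX').1⟩
  have hskew𝔤K : ∀ Y ∈ 𝔤K, ∀ v w, ψ₂.form (Y v) w + ψ₂.form v (Y w) = 0 :=
    fun Y hY => hskew𝔤₂ Y (h𝔤Kle hY)
  have hc₂X₀ : π₂ ∘ₗ X₀ ∘ₗ ι₂ ≠ 0 := by
    intro h0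
    obtain ⟨hX₀𝔞, hc₁X₀⟩ := hKmem.1 hX₀K
    apply hX₀ne
    rw [eq_incl_corner_add hπι₁ hπι₂ hsum (hP₁ X₀ hX₀𝔞) (hP₂ X₀ hX₀𝔞), hc₁X₀, h0]
    simp only [LinearMap.zero_comp, LinearMap.comp_zero, add_zero]
  have hI0 : spanC 𝔤K ≠ ⊥ := by
    intro hbot
    apply hc₂X₀
    have hmem : (π₂ ∘ₗ X₀ ∘ₗ ι₂).baseChange ℂ ∈ spanC 𝔤K := baseChange_mem_spanC (h𝔤Kmem.2 ⟨X₀, hX₀K, rfl⟩)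
    rw [hbot, Submodule.mem_bot] at hmem
    have h : π₂ ∘ₗ X₀ ∘ₗ ι₂ ∈ (⊥ : Submodule ℚ (Module.End ℚ V₂)) :=
      mem_of_baseChange_mem_spanC ⊥ (by rw [hmem]; exact Submodule.zero_mem _)
    exact (Submodule.mem_bot ℚ).1 h
  have hIskew : ∀ Y ∈ spanC 𝔤K, ∀ x y, ψ₂.form.baseChange ℂ (Y x) y + ψ₂.form.baseChange ℂ x (Y y) = 0 :=
    fun Y hY => ThetaSubalgebra.formBaseChange_add_eq_zero_of_mem_spanC ψ₂ hskew𝔤K hY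
  have hIideal : ∀ Zc : Module.End ℂ (ℂ ⊗[ℚ] V₂),
      (∀ x y, ψ₂.form.baseChange ℂ (Zc x) y + ψ₂.form.baseChange ℂ x (Zc y) = 0) →
        ∀ Y ∈ spanC 𝔤K, Zc * Y - Y * Zc ∈ spanC 𝔤K :=
    fun Zc hZc Y hY => bracket_mem_spanC_of_forall hideal𝔤K (hfull₂ Zc hZc) hY
  -- (IDEAL): `Θ₂ ∈ c₂(K)_ℂ`; (RIGID): `c₂(K)_ℂ` is everything skew
  have hΘK : Θ₂ ∈ spanC 𝔤K :=
    SymplecticIdeal.theta_mem_of_ne_bot_hodge H₂ hn heff₂ ψ₂ hΘ₂ _ hIskew hIideal hI0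
  have hbr𝔤K : ∀ Y ∈ 𝔤K, ∀ Y' ∈ 𝔤K, Y * Y' - Y' * Y ∈ 𝔤K := fun Y hY Y' hY' =>
    hideal𝔤K Y (h𝔤Kle hY) Y' hY'
  have hfullK : ∀ Y : Module.End ℂ (ℂ ⊗[ℚ] V₂),
      (∀ x y, ψ₂.form.baseChange ℂ (Y x) y + ψ₂.form.baseChange ℂ x (Y y) = 0) → Y ∈ spanC 𝔤K :=
    hrigid 𝔤K hbr𝔤K hskew𝔤K hΘK
  -- descent: every rational skew `Z₂` is `c₂` of an element `ι₂ Z₂ π₂` of `K`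
  have hconcl₂ : ∀ Z₂ : Module.End ℚ V₂, (∀ v w, ψ₂.form (Z₂ v) w + ψ₂.form v (Z₂ w) = 0) →
      ι₂ ∘ₗ Z₂ ∘ₗ π₂ ∈ 𝔞 := by
    intro Z₂ hZ₂
    have hmemC : Z₂.baseChange ℂ ∈ spanC 𝔤K :=
      hfullK _ (ThetaSubalgebra.formBaseChange_add_eq_zero_of_skew ψ₂ hZ₂)
    obtain ⟨X, hXK, hXeq⟩ := h𝔤Kmem.1 (mem_of_baseChange_mem_spanC 𝔤K hmemC)
    obtain ⟨hX𝔞, hc₁X⟩ := hKmem.1 hXK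
    have hdec := eq_incl_corner_add hπι₁ hπι₂ hsum (hP₁ X hX𝔞) (hP₂ X hX𝔞)
    rw [hc₁X, hXeq] at hdec
    simp only [LinearMap.zero_comp, LinearMap.comp_zero, zero_add] at hdec
    rw [← hdec]
    exact hX𝔞
  refine ⟨fun X hX => ?_, hconcl₂⟩
  have hdec := eq_incl_corner_add hπι₁ hπι₂ hsum (hP₁ X hX) (hP₂ X hX)
  have h2 : ι₂ ∘ₗ (π₂ ∘ₗ X ∘ₗ ι₂) ∘ₗ π₂ ∈ 𝔞 := hconcl₂ _ (hskew₂ X hX)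
  have heq : ι₁ ∘ₗ (π₁ ∘ₗ X ∘ₗ ι₁) ∘ₗ π₁ = X - ι₂ ∘ₗ (π₂ ∘ₗ X ∘ₗ ι₂) ∘ₗ π₂ :=
    eq_sub_of_add_eq hdec.symm
  rw [heq]
  exact Submodule.sub_mem _ hX h2

end Goursat

/-! ### §4 The theorems: `hg(X₁) ⊕ 0` and `0 ⊕ 𝔰𝔩₂(V₂ ⊗ ℂ)` kill every rational tensor killed by `Θ_U` -/

section Main

universe u

variable {U V₁ V₂ : Type u} [AddCommGroup U] [Module ℚ U] [AddCommGroup V₁] [Module ℚ V₁]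
  [AddCommGroup V₂] [Module ℚ V₂] [Module.Finite ℚ U] [Module.Finite ℚ V₁] [Module.Finite ℚ V₂]
  [HodgeTensorFacts.{u, u}] {n : ℤ}
variable {M d m : ℕ}

omit [Module.Finite ℚ U] [Module.Finite ℚ V₁] [Module.Finite ℚ V₂] [HodgeTensorFacts.{u, u}] in
/-- Complexification of a sum of bilinear forms, evaluated (a copy of the private lemma of
`HodgeThetaAnnihilatorRealBlocksTimesSymplectic`). [folklore] -/
private theorem baseChange_add_apply' (B B' : LinearMap.BilinForm ℚ U) (x y : ℂ ⊗[ℚ] U) :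
    LinearMap.BilinForm.baseChange ℂ (B + B') x y =
      LinearMap.BilinForm.baseChange ℂ B x y + LinearMap.BilinForm.baseChange ℂ B' x y := by
  induction x using TensorProduct.induction_on with
  | zero => simp
  | tmul c v =>
    induction y using TensorProduct.induction_on with
    | zero => simp
    | tmul d w =>
      simp only [LinearMap.BilinForm.baseChange_tmul, LinearMap.add_apply, add_smul]
    | add y y' hy hy' => rw [map_add, map_add, map_add, hy, hy']; abel
  | add x x' hx hx' =>
    rw [map_add, LinearMap.add_apply, map_add, map_add, LinearMap.add_apply, LinearMap.add_apply, hx, hx']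
    abel

omit [Module.Finite ℚ V₁] [Module.Finite ℚ V₂] [HodgeTensorFacts.{u, u}] in
/-- **`Hom = 0` in the `Θ`-form.** If no non-zero `f : V₂ → V₁` maps `V₂^{p,1-p}` into `V₁^{p,1-p}` (no non-zero
morphism of Hodge structures), then no non-zero `f` intertwines the Hodge operators: `Θ₁ f_ℂ = f_ℂ Θ₂` makes
`f_ℂ x` (`x ∈ V₂^{p,1-p}`) an eigenvector of `Θ₁` with eigenvalue `2p - 1`, i.e. an element of `V₁^{p,1-p}`
(`V₁^{1,0} = {Θ₁ = 1}`, `V₁^{0,1} = {Θ₁ = -1}` in effective weight one, `UnitaryTheta.theta_facts`).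
[cite: Deligne1982HodgeCycles, I §3 Prop. 3.4] [cite: MoonenZarhin1999LowDim, §3 (3.1)] -/
theorem eq_zero_of_theta_comp_eq_of_hom_eq_zero (hn : n = 1) (H₁ : HodgeStructure V₁ n) (H₂ : HodgeStructure V₂ n)
    (heff₁ : H₁.IsEffective) (heff₂ : H₂.IsEffective)
    {Θ₁ : Module.End ℂ (ℂ ⊗[ℚ] V₁)} (hΘ₁ : ∀ p, ∀ x ∈ H₁.piece p (n - p), Θ₁ x = ((2 * p - n : ℤ) : ℂ) • x)
    {Θ₂ : Module.End ℂ (ℂ ⊗[ℚ] V₂)} (hΘ₂ : ∀ p, ∀ x ∈ H₂.piece p (n - p), Θ₂ x = ((2 * p - n : ℤ) : ℂ) • x)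
    (hHom : ∀ f : V₂ →ₗ[ℚ] V₁,
      (∀ p, ∀ x ∈ H₂.piece p (n - p), f.baseChange ℂ x ∈ H₁.piece p (n - p)) → f = 0)
    {f : V₂ →ₗ[ℚ] V₁} (hf : Θ₁ ∘ₗ f.baseChange ℂ = f.baseChange ℂ ∘ₗ Θ₂) : f = 0 := by
  obtain ⟨hP₁', hQ₁', -, -, -⟩ := UnitaryTheta.theta_facts H₁ hn heff₁ hΘ₁
  refine hHom f fun p x hx => ?_
  have hfx : Θ₁ (f.baseChange ℂ x) = ((2 * p - n : ℤ) : ℂ) • f.baseChange ℂ x := by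
    have h := LinearMap.congr_fun hf x
    simp only [LinearMap.comp_apply] at h
    rw [h, hΘ₂ p x hx, map_smul]
  subst hn
  by_cases hp1 : p = 1
  · subst hp1
    have e : ((2 * (1 : ℤ) - 1 : ℤ) : ℂ) = 1 := by norm_num
    rw [e, one_smul] at hfx
    have hmem := hP₁' (f.baseChange ℂ x)
    rw [hfx, ← two_smul ℂ, smul_smul, inv_mul_cancel₀ (two_ne_zero (α := ℂ)), one_smul] at hmem
    simpa using hmem
  · by_cases hp0 : p = 0
    · subst hp0
      have e : ((2 * (0 : ℤ) - 1 : ℤ) : ℂ) = -1 := by norm_num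
      rw [e, neg_one_smul] at hfx
      have hmem := hQ₁' (f.baseChange ℂ x)
      rw [hfx, sub_neg_eq_add, ← two_smul ℂ, smul_smul, inv_mul_cancel₀ (two_ne_zero (α := ℂ)), one_smul] at hmem
      simpa using hmem
    · have hbot : H₂.piece p (1 - p) = ⊥ := by
        by_contra h
        have h' := heff₂ p (1 - p) h
        omega
      rw [hbot, Submodule.mem_bot] at hx
      rw [hx, map_zero]
      exact Submodule.zero_mem _

/-- **The core (Moonen–Zarhin Lemma (3.4) for `g = 1`, Lie form, word model).** For the annihilator algebra
`𝔞 = annLie φ eQ aF q` of a rational tensor `q` on `U = ι₁V₁ ⊕ ι₂V₂` killed by `Θ_U` (`φ = ψ₁(π₁·,π₁·) +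
ψ₂(π₂·,π₂·)`; `aF` = the Hodge endomorphisms `ι₁ a π₁`, `a ∈ End_Hdg(V₁)`, and the two projectors), where
`V₂` has `dim V₂ = 2`, `End_Hdg(V₂) = ℚ` (a non-CM elliptic curve) and `Hom_Hdg(V₂, V₁) = 0`:
`ι₁ c₁X π₁ ∈ 𝔞` for all `X ∈ 𝔞`, `ι₂ Z π₂ ∈ 𝔞` for all rational `ψ₂`-skew `Z`, and `Θ_U ∈ 𝔞_ℂ`
(«`hg(X₁ × X₂) = hg(X₁) × hg(X₂)`»). [cite: MoonenZarhin1999LowDim, §3 (3.1) and Lemma (3.4)]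
[cite: Deligne1982HodgeCycles, I §3 (proof of Prop. 3.4)] -/
theorem incl_corner_mem_annLie_of_times_nonCMCurve (hn : n = 1) (HU : HodgeStructure U n)
    (H₁ : HodgeStructure V₁ n) (H₂ : HodgeStructure V₂ n) (heff₁ : H₁.IsEffective) (heff₂ : H₂.IsEffective)
    {ι₁ : V₁ →ₗ[ℚ] U} {π₁ : U →ₗ[ℚ] V₁} {ι₂ : V₂ →ₗ[ℚ] U} {π₂ : U →ₗ[ℚ] V₂}
    (hπι₁ : π₁ ∘ₗ ι₁ = LinearMap.id) (hπι₂ : π₂ ∘ₗ ι₂ = LinearMap.id) (hπ₁ι₂ : π₁ ∘ₗ ι₂ = 0)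
    (hπ₂ι₁ : π₂ ∘ₗ ι₁ = 0) (hsum : ι₁ ∘ₗ π₁ + ι₂ ∘ₗ π₂ = LinearMap.id)
    (hι₁F : ∀ p, ∀ x ∈ H₁.piece p (n - p), ι₁.baseChange ℂ x ∈ HU.piece p (n - p))
    (hι₂F : ∀ p, ∀ x ∈ H₂.piece p (n - p), ι₂.baseChange ℂ x ∈ HU.piece p (n - p))
    (ψ₁ : H₁.Polarization) (ψ₂ : H₂.Polarization)
    (hE₂ : ∀ a ∈ H₂.endAlg, ∃ x : ℚ, a = x • 1) (hV₂ : Module.finrank ℚ V₂ = 2)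
    (hHom : ∀ f : V₂ →ₗ[ℚ] V₁,
      (∀ p, ∀ x ∈ H₂.piece p (n - p), f.baseChange ℂ x ∈ H₁.piece p (n - p)) → f = 0)
    (eQ : Module.Basis (Fin M) ℚ U) (q : (Fin d → Fin m × Fin M) → ℚ)
    {ΘU : Module.End ℂ (ℂ ⊗[ℚ] U)} (hΘU : ∀ p, ∀ x ∈ HU.piece p (n - p), ΘU x = ((2 * p - n : ℤ) : ℂ) • x)
    (hΘq : ∀ u : Fin d → Fin m, wordDerAt ℂ (fun _ : Fin d =>
      LinearMap.toMatrix (Algebra.TensorProduct.basis ℂ eQ) (Algebra.TensorProduct.basis ℂ eQ) ΘU)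
      (wordSlice (fun w => algebraMap ℚ ℂ (q w)) u) = 0) :
    (∀ X ∈ annLie (ψ₁.form.compl₁₂ π₁ π₁ + ψ₂.form.compl₁₂ π₂ π₂) eQ
        (Sum.elim (fun a : H₁.endAlg => ι₁ ∘ₗ (a : Module.End ℚ V₁) ∘ₗ π₁)
          (Sum.elim (fun _ : Unit => ι₁ ∘ₗ π₁) (fun _ : Unit => ι₂ ∘ₗ π₂))) q,
      ι₁ ∘ₗ (π₁ ∘ₗ X ∘ₗ ι₁) ∘ₗ π₁ ∈ annLie (ψ₁.form.compl₁₂ π₁ π₁ + ψ₂.form.compl₁₂ π₂ π₂) eQ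
        (Sum.elim (fun a : H₁.endAlg => ι₁ ∘ₗ (a : Module.End ℚ V₁) ∘ₗ π₁)
          (Sum.elim (fun _ : Unit => ι₁ ∘ₗ π₁) (fun _ : Unit => ι₂ ∘ₗ π₂))) q) ∧
    (∀ Z₂ : Module.End ℚ V₂, (∀ v w, ψ₂.form (Z₂ v) w + ψ₂.form v (Z₂ w) = 0) →
      ι₂ ∘ₗ Z₂ ∘ₗ π₂ ∈ annLie (ψ₁.form.compl₁₂ π₁ π₁ + ψ₂.form.compl₁₂ π₂ π₂) eQ
        (Sum.elim (fun a : H₁.endAlg => ι₁ ∘ₗ (a : Module.End ℚ V₁) ∘ₗ π₁)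
          (Sum.elim (fun _ : Unit => ι₁ ∘ₗ π₁) (fun _ : Unit => ι₂ ∘ₗ π₂))) q) ∧
    ΘU ∈ spanC (annLie (ψ₁.form.compl₁₂ π₁ π₁ + ψ₂.form.compl₁₂ π₂ π₂) eQ
        (Sum.elim (fun a : H₁.endAlg => ι₁ ∘ₗ (a : Module.End ℚ V₁) ∘ₗ π₁)
          (Sum.elim (fun _ : Unit => ι₁ ∘ₗ π₁) (fun _ : Unit => ι₂ ∘ₗ π₂))) q) := by
  classical
  obtain ⟨Θ₁, hΘ₁⟩ := exists_hodgeTheta H₁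
  obtain ⟨Θ₂, hΘ₂⟩ := exists_hodgeTheta H₂
  have hΘ₁C : Θ₁ ∈ H₁.hodgeLieC := H₁.mem_hodgeLieC_of_forall_piece hΘ₁
  have hΘ₂C : Θ₂ ∈ H₂.hodgeLieC := H₂.mem_hodgeLieC_of_forall_piece hΘ₂
  have hsum' : ι₂ ∘ₗ π₂ + ι₁ ∘ₗ π₁ = LinearMap.id := by rw [add_comm]; exact hsum
  have e11 : ∀ v, π₁ (ι₁ v) = v := fun v => by
    rw [← LinearMap.comp_apply (f := π₁), hπι₁, LinearMap.id_apply]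
  have e22 : ∀ w, π₂ (ι₂ w) = w := fun w => by
    rw [← LinearMap.comp_apply (f := π₂), hπι₂, LinearMap.id_apply]
  have e12 : ∀ w, π₁ (ι₂ w) = 0 := fun w => by
    rw [← LinearMap.comp_apply (f := π₁), hπ₁ι₂, LinearMap.zero_apply]
  have e21 : ∀ v, π₂ (ι₁ v) = 0 := fun v => by
    rw [← LinearMap.comp_apply (f := π₂), hπ₂ι₁, LinearMap.zero_apply]
  -- `Θ` through the presentation
  have hΘι₁ := theta_incl_eq HU H₁ hι₁F hΘU hΘ₁
  have hΘι₂ := theta_incl_eq HU H₂ hι₂F hΘU hΘ₂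
  have hΘπ₁ := proj_theta_eq HU H₁ H₂ hπι₁ hπ₁ι₂ hsum hι₁F hι₂F hΘU hΘ₁ hΘ₂
  have hΘπ₂ := proj_theta_eq HU H₂ H₁ hπι₂ hπ₂ι₁ hsum' hι₂F hι₁F hΘU hΘ₂ hΘ₁
  -- the commuting family and the orthogonal-sum form
  set aF : H₁.endAlg ⊕ (Unit ⊕ Unit) → Module.End ℚ U :=
    Sum.elim (fun a : H₁.endAlg => ι₁ ∘ₗ (a : Module.End ℚ V₁) ∘ₗ π₁)
      (Sum.elim (fun _ : Unit => ι₁ ∘ₗ π₁) (fun _ : Unit => ι₂ ∘ₗ π₂)) with haF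
  set φ : LinearMap.BilinForm ℚ U := ψ₁.form.compl₁₂ π₁ π₁ + ψ₂.form.compl₁₂ π₂ π₂ with hφ
  have hφC : ∀ x y, φ.baseChange ℂ x y = ψ₁.form.baseChange ℂ (π₁.baseChange ℂ x) (π₁.baseChange ℂ y) +
      ψ₂.form.baseChange ℂ (π₂.baseChange ℂ x) (π₂.baseChange ℂ y) := fun x y => by
    rw [hφ, baseChange_add_apply', baseChange_compl₁₂_apply, baseChange_compl₁₂_apply]
  have hφapply : ∀ x y, φ x y = ψ₁.form (π₁ x) (π₁ y) + ψ₂.form (π₂ x) (π₂ y) := fun x y => by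
    rw [hφ, LinearMap.add_apply, LinearMap.add_apply, LinearMap.compl₁₂_apply, LinearMap.compl₁₂_apply]
  set 𝔞 : Submodule ℚ (Module.End ℚ U) := annLie φ eQ aF q with h𝔞
  -- `Θ_U ∈ 𝔞_ℂ`
  have hΘ𝔞 : ΘU ∈ spanC 𝔞 := by
    refine mem_spanC_annLie φ eQ aF q hΘq (fun i => ?_) (fun x y => ?_)
    · apply LinearMap.ext
      intro y
      rcases i with a | (_ | _)
      · change ΘU ((ι₁ ∘ₗ (a : Module.End ℚ V₁) ∘ₗ π₁).baseChange ℂ y) =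
          (ι₁ ∘ₗ (a : Module.End ℚ V₁) ∘ₗ π₁).baseChange ℂ (ΘU y)
        simp only [LinearMap.baseChange_comp, LinearMap.comp_apply]
        rw [hΘι₁, ← Module.End.mul_apply (f := Θ₁), commute_baseChange_of_mem_hodgeLieC H₁ hΘ₁C a,
          Module.End.mul_apply, hΘπ₁]
      · change ΘU ((ι₁ ∘ₗ π₁).baseChange ℂ y) = (ι₁ ∘ₗ π₁).baseChange ℂ (ΘU y)
        simp only [LinearMap.baseChange_comp, LinearMap.comp_apply]
        rw [hΘι₁, hΘπ₁]
      · change ΘU ((ι₂ ∘ₗ π₂).baseChange ℂ y) = (ι₂ ∘ₗ π₂).baseChange ℂ (ΘU y)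
        simp only [LinearMap.baseChange_comp, LinearMap.comp_apply]
        rw [hΘι₂, hΘπ₂]
    · rw [hφC, hφC, hΘπ₁, hΘπ₁, hΘπ₂, hΘπ₂, formBaseChange_skew_of_mem_hodgeLieC ψ₁ hΘ₁C,
        formBaseChange_skew_of_mem_hodgeLieC ψ₂ hΘ₂C]
      ring
  -- what membership in `𝔞` gives
  have hbr𝔞 : ∀ X ∈ 𝔞, ∀ X' ∈ 𝔞, X * X' - X' * X ∈ 𝔞 := fun X hX X' hX' =>
    commutator_mem_annLie φ eQ aF q hX hX'
  have hmem : ∀ X ∈ 𝔞, (∀ i, X * aF i = aF i * X) ∧ ∀ v w, φ (X v) w + φ v (X w) = 0 :=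
    fun X hX => ((mem_annLie_iff φ eQ aF q X).1 hX).2
  have hP₁ : ∀ X ∈ 𝔞, X * (ι₁ ∘ₗ π₁) = (ι₁ ∘ₗ π₁) * X := fun X hX => (hmem X hX).1 (Sum.inr (Sum.inl ()))
  have hP₂ : ∀ X ∈ 𝔞, X * (ι₂ ∘ₗ π₂) = (ι₂ ∘ₗ π₂) * X := fun X hX => (hmem X hX).1 (Sum.inr (Sum.inr ()))
  have hc₁skew : ∀ X ∈ 𝔞, ∀ v w, ψ₁.form ((π₁ ∘ₗ X ∘ₗ ι₁) v) w + ψ₁.form v ((π₁ ∘ₗ X ∘ₗ ι₁) w) = 0 := by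
    intro X hX v w
    have h := (hmem X hX).2 (ι₁ v) (ι₁ w)
    rw [apply_incl_eq_of_commute_projector hπι₁ (hP₁ X hX) v,
      apply_incl_eq_of_commute_projector hπι₁ (hP₁ X hX) w, hφapply, hφapply] at h
    simp only [e11, e21, map_zero, add_zero] at h
    simpa only [LinearMap.comp_apply] using h
  have hc₂skew : ∀ X ∈ 𝔞, ∀ v w, ψ₂.form ((π₂ ∘ₗ X ∘ₗ ι₂) v) w + ψ₂.form v ((π₂ ∘ₗ X ∘ₗ ι₂) w) = 0 := by
    intro X hX v w
    have h := (hmem X hX).2 (ι₂ v) (ι₂ w)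
    rw [apply_incl_eq_of_commute_projector hπι₂ (hP₂ X hX) v,
      apply_incl_eq_of_commute_projector hπι₂ (hP₂ X hX) w, hφapply, hφapply] at h
    simp only [e22, e12, map_zero, zero_add] at h
    simpa only [LinearMap.comp_apply] using h
  -- (HOM) in the `Θ`-form and the Goursat step
  have hHom' : ∀ f : V₂ →ₗ[ℚ] V₁, Θ₁ ∘ₗ f.baseChange ℂ = f.baseChange ℂ ∘ₗ Θ₂ → f = 0 := fun f hf =>
    eq_zero_of_theta_comp_eq_of_hom_eq_zero hn H₁ H₂ heff₁ heff₂ hΘ₁ hΘ₂ hHom hf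
  obtain ⟨h1, h2⟩ := goursat_incl_corner_mem_of_hom_eq_zero hn H₁ H₂ heff₁ heff₂ hπι₁ hπι₂ hπ₁ι₂ hπ₂ι₁ hsum 𝔞
    hbr𝔞 hP₁ hP₂ ψ₁ ψ₂ hc₁skew hc₂skew hE₂ hV₂ hΘ₁ hΘ₂ hΘ𝔞 hΘι₁ hΘι₂ hHom'
  exact ⟨h1, h2, hΘ𝔞⟩

/-- **`0 ⊕ 𝔰𝔭(V₂ ⊗ ℂ) ⊆ 𝔞(q)_ℂ`**: with the hypotheses of the core theorem, `ι₂ ∘ Y ∘ π₂ ∈ 𝔞(q)_ℂ` for EVERY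
`ψ₂`-skew operator `Y` of `V₂ ⊗ ℂ` («`Hg(X₁ × X₂) ⊇ 1 × Hg(X₂) = 1 × SL₂`» read on tensors).
[cite: MoonenZarhin1999LowDim, §3 (3.1) and Lemma (3.4)] [cite: Deligne1982HodgeCycles, I §3 (proof of Prop. 3.4)] -/
theorem incl₂_comp_proj_mem_spanC_annLie_of_times_nonCMCurve (hn : n = 1) (HU : HodgeStructure U n)
    (H₁ : HodgeStructure V₁ n) (H₂ : HodgeStructure V₂ n) (heff₁ : H₁.IsEffective) (heff₂ : H₂.IsEffective)
    {ι₁ : V₁ →ₗ[ℚ] U} {π₁ : U →ₗ[ℚ] V₁} {ι₂ : V₂ →ₗ[ℚ] U} {π₂ : U →ₗ[ℚ] V₂}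
    (hπι₁ : π₁ ∘ₗ ι₁ = LinearMap.id) (hπι₂ : π₂ ∘ₗ ι₂ = LinearMap.id) (hπ₁ι₂ : π₁ ∘ₗ ι₂ = 0)
    (hπ₂ι₁ : π₂ ∘ₗ ι₁ = 0) (hsum : ι₁ ∘ₗ π₁ + ι₂ ∘ₗ π₂ = LinearMap.id)
    (hι₁F : ∀ p, ∀ x ∈ H₁.piece p (n - p), ι₁.baseChange ℂ x ∈ HU.piece p (n - p))
    (hι₂F : ∀ p, ∀ x ∈ H₂.piece p (n - p), ι₂.baseChange ℂ x ∈ HU.piece p (n - p))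
    (ψ₁ : H₁.Polarization) (ψ₂ : H₂.Polarization)
    (hE₂ : ∀ a ∈ H₂.endAlg, ∃ x : ℚ, a = x • 1) (hV₂ : Module.finrank ℚ V₂ = 2)
    (hHom : ∀ f : V₂ →ₗ[ℚ] V₁,
      (∀ p, ∀ x ∈ H₂.piece p (n - p), f.baseChange ℂ x ∈ H₁.piece p (n - p)) → f = 0)
    (eQ : Module.Basis (Fin M) ℚ U) (q : (Fin d → Fin m × Fin M) → ℚ)
    {ΘU : Module.End ℂ (ℂ ⊗[ℚ] U)} (hΘU : ∀ p, ∀ x ∈ HU.piece p (n - p), ΘU x = ((2 * p - n : ℤ) : ℂ) • x)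
    (hΘq : ∀ u : Fin d → Fin m, wordDerAt ℂ (fun _ : Fin d =>
      LinearMap.toMatrix (Algebra.TensorProduct.basis ℂ eQ) (Algebra.TensorProduct.basis ℂ eQ) ΘU)
      (wordSlice (fun w => algebraMap ℚ ℂ (q w)) u) = 0)
    {Y : Module.End ℂ (ℂ ⊗[ℚ] V₂)}
    (hY : ∀ x y, ψ₂.form.baseChange ℂ (Y x) y + ψ₂.form.baseChange ℂ x (Y y) = 0) :
    ι₂.baseChange ℂ ∘ₗ Y ∘ₗ π₂.baseChange ℂ ∈ spanC (annLie (ψ₁.form.compl₁₂ π₁ π₁ + ψ₂.form.compl₁₂ π₂ π₂) eQ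
        (Sum.elim (fun a : H₁.endAlg => ι₁ ∘ₗ (a : Module.End ℚ V₁) ∘ₗ π₁)
          (Sum.elim (fun _ : Unit => ι₁ ∘ₗ π₁) (fun _ : Unit => ι₂ ∘ₗ π₂))) q) := by
  classical
  set aF : H₁.endAlg ⊕ (Unit ⊕ Unit) → Module.End ℚ U :=
    Sum.elim (fun a : H₁.endAlg => ι₁ ∘ₗ (a : Module.End ℚ V₁) ∘ₗ π₁)
      (Sum.elim (fun _ : Unit => ι₁ ∘ₗ π₁) (fun _ : Unit => ι₂ ∘ₗ π₂)) with haF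
  set φ : LinearMap.BilinForm ℚ U := ψ₁.form.compl₁₂ π₁ π₁ + ψ₂.form.compl₁₂ π₂ π₂ with hφ
  set 𝔞 : Submodule ℚ (Module.End ℚ U) := annLie φ eQ aF q with h𝔞
  obtain ⟨-, h2, hΘ𝔞⟩ := incl_corner_mem_annLie_of_times_nonCMCurve hn HU H₁ H₂ heff₁ heff₂ hπι₁ hπι₂ hπ₁ι₂ hπ₂ι₁ hsum hι₁F hι₂F ψ₁ ψ₂ hE₂ hV₂ hHom eQ q hΘU hΘq
  obtain ⟨Θ₂, hΘ₂⟩ := exists_hodgeTheta H₂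
  -- the rational Lie algebra of all `ψ₂`-skew operators and (RIGID) for it
  let 𝔰 : Submodule ℚ (Module.End ℚ V₂) :=
    { carrier := {X | ∀ v w, ψ₂.form (X v) w + ψ₂.form v (X w) = 0}
      zero_mem' := fun v w => by simp
      add_mem' := by
        intro X X' hX hX' v w
        simp only [LinearMap.add_apply, map_add]
        have h1 := hX v w
        have h2 := hX' v w
        linear_combination h1 + h2
      smul_mem' := by
        intro c X hX v w
        simp only [LinearMap.smul_apply, map_smul, smul_eq_mul]
        have h1 := hX v w
        linear_combination c * h1 }
  have hmem𝔰 : ∀ X, X ∈ 𝔰 ↔ ∀ v w, ψ₂.form (X v) w + ψ₂.form v (X w) = 0 := fun X => Iff.rfl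
  have h𝔰br : ∀ X ∈ 𝔰, ∀ X' ∈ 𝔰, X * X' - X' * X ∈ 𝔰 := by
    intro X hX X' hX'
    rw [hmem𝔰] at hX hX' ⊢
    intro v w
    simp only [LinearMap.sub_apply, Module.End.mul_apply, map_sub, LinearMap.sub_apply]
    have h1 := hX (X' v) w
    have h2 := hX' v (X w)
    have h3 := hX' (X v) w
    have h4 := hX v (X' w)
    linear_combination h1 - h3 + h4 - h2
  have h𝔰skew : ∀ X ∈ 𝔰, ∀ v w, ψ₂.form (X v) w + ψ₂.form v (X w) = 0 := fun X hX => (hmem𝔰 X).1 hX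
  -- `Θ₂ ∈ 𝔰_ℂ`: the second corners of `𝔞` are `ψ₂`-skew and `Θ₂ = c₂ Θ_U`
  have hΘι₂ := theta_incl_eq HU H₂ hι₂F hΘU hΘ₂
  have e22 : ∀ w, π₂ (ι₂ w) = w := fun w => by
    rw [← LinearMap.comp_apply (f := π₂), hπι₂, LinearMap.id_apply]
  have e12 : ∀ w, π₁ (ι₂ w) = 0 := fun w => by
    rw [← LinearMap.comp_apply (f := π₁), hπ₁ι₂, LinearMap.zero_apply]
  have hmem : ∀ X ∈ 𝔞, (∀ i, X * aF i = aF i * X) ∧ ∀ v w, φ (X v) w + φ v (X w) = 0 :=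
    fun X hX => ((mem_annLie_iff φ eQ aF q X).1 hX).2
  have hP₂ : ∀ X ∈ 𝔞, X * (ι₂ ∘ₗ π₂) = (ι₂ ∘ₗ π₂) * X := fun X hX => (hmem X hX).1 (Sum.inr (Sum.inr ()))
  have hφapply : ∀ x y, φ x y = ψ₁.form (π₁ x) (π₁ y) + ψ₂.form (π₂ x) (π₂ y) := fun x y => by
    rw [hφ, LinearMap.add_apply, LinearMap.add_apply, LinearMap.compl₁₂_apply, LinearMap.compl₁₂_apply]
  have hc₂𝔰 : ∀ X ∈ 𝔞, π₂ ∘ₗ X ∘ₗ ι₂ ∈ 𝔰 := by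
    intro X hX
    rw [hmem𝔰]
    intro v w
    have h := (hmem X hX).2 (ι₂ v) (ι₂ w)
    rw [apply_incl_eq_of_commute_projector hπι₂ (hP₂ X hX) v,
      apply_incl_eq_of_commute_projector hπι₂ (hP₂ X hX) w, hφapply, hφapply] at h
    simp only [e22, e12, map_zero, zero_add] at h
    simpa only [LinearMap.comp_apply] using h
  have hcorner₂ : ∀ T ∈ spanC 𝔞, π₂.baseChange ℂ ∘ₗ T ∘ₗ ι₂.baseChange ℂ ∈ spanC 𝔰 := by
    intro T hT
    induction hT using Submodule.span_induction with
    | mem Z' hZ' =>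
      obtain ⟨X, hX, rfl⟩ := hZ'
      rw [← LinearMap.baseChange_comp, ← LinearMap.baseChange_comp]
      exact baseChange_mem_spanC (hc₂𝔰 X hX)
    | zero => rw [LinearMap.zero_comp, LinearMap.comp_zero]; exact Submodule.zero_mem _
    | add Z' Z'' _ _ hZ' hZ'' => rw [LinearMap.add_comp, LinearMap.comp_add]; exact Submodule.add_mem _ hZ' hZ''
    | smul c Z' _ hZ' => rw [LinearMap.smul_comp, LinearMap.comp_smul]; exact Submodule.smul_mem _ c hZ'
  have hΘ𝔰 : Θ₂ ∈ spanC 𝔰 := by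
    have h : Θ₂ = π₂.baseChange ℂ ∘ₗ ΘU ∘ₗ ι₂.baseChange ℂ := by
      apply LinearMap.ext
      intro x
      rw [LinearMap.comp_apply, LinearMap.comp_apply, hΘι₂, proj_incl_baseChange hπι₂]
    rw [h]
    exact hcorner₂ ΘU hΘ𝔞
  have hY𝔰 : Y ∈ spanC 𝔰 := RankTwoTheta.mem_spanC_of_skew H₂ hn heff₂ ψ₂ hE₂ hV₂ 𝔰 h𝔰br hΘ₂ hΘ𝔰 h𝔰skew hY
  -- elements of `𝔰_ℂ`, placed on `V₂`, lie in `𝔞_ℂ`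
  have hplace : ∀ Y' ∈ spanC 𝔰, ι₂.baseChange ℂ ∘ₗ Y' ∘ₗ π₂.baseChange ℂ ∈ spanC 𝔞 := by
    intro Y' hY'
    induction hY' using Submodule.span_induction with
    | mem Y₁ hY₁ =>
      obtain ⟨X, hX, rfl⟩ := hY₁
      rw [← LinearMap.baseChange_comp, ← LinearMap.baseChange_comp]
      exact baseChange_mem_spanC (h2 X ((hmem𝔰 X).1 hX))
    | zero => rw [LinearMap.zero_comp, LinearMap.comp_zero]; exact Submodule.zero_mem _
    | add Y₁ Y₂ _ _ hY₁ hY₂ => rw [LinearMap.add_comp, LinearMap.comp_add]; exact Submodule.add_mem _ hY₁ hY₂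
    | smul c Y₁ _ hY₁ => rw [LinearMap.smul_comp, LinearMap.comp_smul]; exact Submodule.smul_mem _ c hY₁
  exact hplace _ hY𝔰

/-- **Theorem (second factor, word model): the rational `Θ_U`-killed tensor `q` on `U = H¹(X) ⊕ H¹(E)` is killed
by the matrix of `ι₂ ∘ Y ∘ π₂` for EVERY `ψ₂`-skew operator `Y` of `H¹(E) ⊗ ℂ`** (`E` a non-CM elliptic curve,
`Hom(X, E) = 0`): «`Hg(X × E) ⊇ 1 × SL₂`» read on tensors. [cite: MoonenZarhin1999LowDim, §3 (3.1) and Lemma (3.4)]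
[cite: Deligne1982HodgeCycles, I §3 (proof of Prop. 3.4)] -/
theorem wordDerAt_incl₂_eq_zero_of_times_nonCMCurve (hn : n = 1) (HU : HodgeStructure U n)
    (H₁ : HodgeStructure V₁ n) (H₂ : HodgeStructure V₂ n) (heff₁ : H₁.IsEffective) (heff₂ : H₂.IsEffective)
    {ι₁ : V₁ →ₗ[ℚ] U} {π₁ : U →ₗ[ℚ] V₁} {ι₂ : V₂ →ₗ[ℚ] U} {π₂ : U →ₗ[ℚ] V₂}
    (hπι₁ : π₁ ∘ₗ ι₁ = LinearMap.id) (hπι₂ : π₂ ∘ₗ ι₂ = LinearMap.id) (hπ₁ι₂ : π₁ ∘ₗ ι₂ = 0)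
    (hπ₂ι₁ : π₂ ∘ₗ ι₁ = 0) (hsum : ι₁ ∘ₗ π₁ + ι₂ ∘ₗ π₂ = LinearMap.id)
    (hι₁F : ∀ p, ∀ x ∈ H₁.piece p (n - p), ι₁.baseChange ℂ x ∈ HU.piece p (n - p))
    (hι₂F : ∀ p, ∀ x ∈ H₂.piece p (n - p), ι₂.baseChange ℂ x ∈ HU.piece p (n - p))
    (ψ₁ : H₁.Polarization) (ψ₂ : H₂.Polarization)
    (hE₂ : ∀ a ∈ H₂.endAlg, ∃ x : ℚ, a = x • 1) (hV₂ : Module.finrank ℚ V₂ = 2)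
    (hHom : ∀ f : V₂ →ₗ[ℚ] V₁,
      (∀ p, ∀ x ∈ H₂.piece p (n - p), f.baseChange ℂ x ∈ H₁.piece p (n - p)) → f = 0)
    (eQ : Module.Basis (Fin M) ℚ U) (q : (Fin d → Fin m × Fin M) → ℚ)
    {ΘU : Module.End ℂ (ℂ ⊗[ℚ] U)} (hΘU : ∀ p, ∀ x ∈ HU.piece p (n - p), ΘU x = ((2 * p - n : ℤ) : ℂ) • x)
    (hΘq : ∀ u : Fin d → Fin m, wordDerAt ℂ (fun _ : Fin d =>
      LinearMap.toMatrix (Algebra.TensorProduct.basis ℂ eQ) (Algebra.TensorProduct.basis ℂ eQ) ΘU)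
      (wordSlice (fun w => algebraMap ℚ ℂ (q w)) u) = 0)
    {Y : Module.End ℂ (ℂ ⊗[ℚ] V₂)}
    (hY : ∀ x y, ψ₂.form.baseChange ℂ (Y x) y + ψ₂.form.baseChange ℂ x (Y y) = 0) (u : Fin d → Fin m) :
    wordDerAt ℂ (fun _ : Fin d =>
      LinearMap.toMatrix (Algebra.TensorProduct.basis ℂ eQ) (Algebra.TensorProduct.basis ℂ eQ)
        (ι₂.baseChange ℂ ∘ₗ Y ∘ₗ π₂.baseChange ℂ))
      (wordSlice (fun w => algebraMap ℚ ℂ (q w)) u) = 0 :=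
  wordDerAt_eq_zero_of_mem_spanC_annLie _ eQ _ q
    (incl₂_comp_proj_mem_spanC_annLie_of_times_nonCMCurve hn HU H₁ H₂ heff₁ heff₂ hπι₁ hπι₂ hπ₁ι₂ hπ₂ι₁ hsum hι₁F hι₂F ψ₁ ψ₂ hE₂ hV₂ hHom eQ q hΘU hΘq hY) u

/-- **`Θ_X ⊕ 0 ∈ 𝔞(q)_ℂ`**: with the hypotheses of the core theorem, the partial Hodge operator
`ι₁ ∘ Θ₁ ∘ π₁ = Θ_U - ι₂ ∘ Θ₂ ∘ π₂` of the first factor lies in `𝔞(q)_ℂ` («`Hg(X × E) ⊇ Hg(X) × 1 ∋` the circle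
`Θ_X`»). [cite: MoonenZarhin1999LowDim, §3 (3.1) and Lemma (3.4)] [cite: Deligne1982HodgeCycles, I §3 (proof of Prop. 3.4)] -/
theorem incl₁_theta_proj_mem_spanC_annLie_of_times_nonCMCurve (hn : n = 1) (HU : HodgeStructure U n)
    (H₁ : HodgeStructure V₁ n) (H₂ : HodgeStructure V₂ n) (heff₁ : H₁.IsEffective) (heff₂ : H₂.IsEffective)
    {ι₁ : V₁ →ₗ[ℚ] U} {π₁ : U →ₗ[ℚ] V₁} {ι₂ : V₂ →ₗ[ℚ] U} {π₂ : U →ₗ[ℚ] V₂}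
    (hπι₁ : π₁ ∘ₗ ι₁ = LinearMap.id) (hπι₂ : π₂ ∘ₗ ι₂ = LinearMap.id) (hπ₁ι₂ : π₁ ∘ₗ ι₂ = 0)
    (hπ₂ι₁ : π₂ ∘ₗ ι₁ = 0) (hsum : ι₁ ∘ₗ π₁ + ι₂ ∘ₗ π₂ = LinearMap.id)
    (hι₁F : ∀ p, ∀ x ∈ H₁.piece p (n - p), ι₁.baseChange ℂ x ∈ HU.piece p (n - p))
    (hι₂F : ∀ p, ∀ x ∈ H₂.piece p (n - p), ι₂.baseChange ℂ x ∈ HU.piece p (n - p))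
    (ψ₁ : H₁.Polarization) (ψ₂ : H₂.Polarization)
    (hE₂ : ∀ a ∈ H₂.endAlg, ∃ x : ℚ, a = x • 1) (hV₂ : Module.finrank ℚ V₂ = 2)
    (hHom : ∀ f : V₂ →ₗ[ℚ] V₁,
      (∀ p, ∀ x ∈ H₂.piece p (n - p), f.baseChange ℂ x ∈ H₁.piece p (n - p)) → f = 0)
    (eQ : Module.Basis (Fin M) ℚ U) (q : (Fin d → Fin m × Fin M) → ℚ)
    {ΘU : Module.End ℂ (ℂ ⊗[ℚ] U)} (hΘU : ∀ p, ∀ x ∈ HU.piece p (n - p), ΘU x = ((2 * p - n : ℤ) : ℂ) • x)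
    (hΘq : ∀ u : Fin d → Fin m, wordDerAt ℂ (fun _ : Fin d =>
      LinearMap.toMatrix (Algebra.TensorProduct.basis ℂ eQ) (Algebra.TensorProduct.basis ℂ eQ) ΘU)
      (wordSlice (fun w => algebraMap ℚ ℂ (q w)) u) = 0)
    {Θ₁ : Module.End ℂ (ℂ ⊗[ℚ] V₁)} (hΘ₁ : ∀ p, ∀ x ∈ H₁.piece p (n - p), Θ₁ x = ((2 * p - n : ℤ) : ℂ) • x) :
    ι₁.baseChange ℂ ∘ₗ Θ₁ ∘ₗ π₁.baseChange ℂ ∈ spanC (annLie (ψ₁.form.compl₁₂ π₁ π₁ + ψ₂.form.compl₁₂ π₂ π₂) eQ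
        (Sum.elim (fun a : H₁.endAlg => ι₁ ∘ₗ (a : Module.End ℚ V₁) ∘ₗ π₁)
          (Sum.elim (fun _ : Unit => ι₁ ∘ₗ π₁) (fun _ : Unit => ι₂ ∘ₗ π₂))) q) := by
  obtain ⟨Θ₂, hΘ₂⟩ := exists_hodgeTheta H₂
  have hΘ₂C : Θ₂ ∈ H₂.hodgeLieC := H₂.mem_hodgeLieC_of_forall_piece hΘ₂
  have hΘ𝔞 := (incl_corner_mem_annLie_of_times_nonCMCurve hn HU H₁ H₂ heff₁ heff₂ hπι₁ hπι₂ hπ₁ι₂ hπ₂ι₁ hsum hι₁F hι₂F ψ₁ ψ₂ hE₂ hV₂ hHom eQ q hΘU hΘq).2.2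
  have h2 := incl₂_comp_proj_mem_spanC_annLie_of_times_nonCMCurve hn HU H₁ H₂ heff₁ heff₂ hπι₁ hπι₂ hπ₁ι₂ hπ₂ι₁ hsum hι₁F hι₂F ψ₁ ψ₂ hE₂ hV₂ hHom eQ q hΘU hΘq (Y := Θ₂)
    (fun x y => by rw [formBaseChange_skew_of_mem_hodgeLieC ψ₂ hΘ₂C, neg_add_cancel])
  have hΘι₁ := theta_incl_eq HU H₁ hι₁F hΘU hΘ₁
  have hΘι₂ := theta_incl_eq HU H₂ hι₂F hΘU hΘ₂
  have hΘUy : ∀ y, ΘU y = ι₁.baseChange ℂ (Θ₁ (π₁.baseChange ℂ y)) + ι₂.baseChange ℂ (Θ₂ (π₂.baseChange ℂ y)) := by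
    intro y
    conv_lhs => rw [← incl_proj_add_baseChange hsum y]
    rw [map_add, hΘι₁, hΘι₂]
  have hdec : ι₁.baseChange ℂ ∘ₗ Θ₁ ∘ₗ π₁.baseChange ℂ = ΘU - ι₂.baseChange ℂ ∘ₗ Θ₂ ∘ₗ π₂.baseChange ℂ := by
    apply LinearMap.ext
    intro y
    simp only [LinearMap.sub_apply, LinearMap.comp_apply, hΘUy, add_sub_cancel_right]
  rw [hdec]
  exact Submodule.sub_mem _ hΘ𝔞 h2

/-- **Theorem (first factor, word model; Moonen–Zarhin Lemma (3.4) with a non-CM elliptic curve).** Let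
`U = ι₁V₁ ⊕ ι₂V₂` be a presentation compatible with effective weight-one Hodge structures `H_U`, `H₁`, `H₂`,
polarizations `ψ₁`, `ψ₂`, with `dim V₂ = 2`, `End_Hdg(V₂) = ℚ` and `Hom_Hdg(V₂, V₁) = 0` («`X₂ = E` an elliptic
curve without complex multiplication and `Hom(X₁, E) = 0`»). If a RATIONAL coefficient tensor `q` on `U` is
killed, slice by slice, by the matrix of the Hodge operator `Θ_U`, then it is killed by the matrix of the
partial Hodge operator `ι₁ ∘ Θ₁ ∘ π₁` of the first factor — the conclusion of the tree's
`wordDerAt_incl_proj_eq_zero_of_forall_lie` (there: `X₁` without factors of type IV and `X₂` of CM type), so the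
typed-Künneth pipeline of programme R5 applies verbatim to `X × E`. («Let `X₁` be an abelian variety with
`hg(X₁)` semi-simple … `X₂` an elliptic curve such that `Hom(X₁,X₂) = 0` and `End⁰(X₁) = End⁰(X₂) = ℚ` … then
`hg(X) = hg(X₁) × hg(X₂)`» — here without the hypotheses on `X₁`, which Moonen–Zarhin use only through the
reductivity of `hg`, supplied by `exists_ideal_compl`.) [cite: MoonenZarhin1999LowDim, §3 (3.1), Lemma (3.4), Remark (3.5)]
[cite: Deligne1982HodgeCycles, I §3 Prop. 3.4 and Prop. 3.6] [cite: Hazama1989, Thm. (= Gordon 7.6.2)] -/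
theorem wordDerAt_incl_proj_theta_eq_zero_of_times_nonCMCurve (hn : n = 1) (HU : HodgeStructure U n)
    (H₁ : HodgeStructure V₁ n) (H₂ : HodgeStructure V₂ n) (heff₁ : H₁.IsEffective) (heff₂ : H₂.IsEffective)
    {ι₁ : V₁ →ₗ[ℚ] U} {π₁ : U →ₗ[ℚ] V₁} {ι₂ : V₂ →ₗ[ℚ] U} {π₂ : U →ₗ[ℚ] V₂}
    (hπι₁ : π₁ ∘ₗ ι₁ = LinearMap.id) (hπι₂ : π₂ ∘ₗ ι₂ = LinearMap.id) (hπ₁ι₂ : π₁ ∘ₗ ι₂ = 0)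
    (hπ₂ι₁ : π₂ ∘ₗ ι₁ = 0) (hsum : ι₁ ∘ₗ π₁ + ι₂ ∘ₗ π₂ = LinearMap.id)
    (hι₁F : ∀ p, ∀ x ∈ H₁.piece p (n - p), ι₁.baseChange ℂ x ∈ HU.piece p (n - p))
    (hι₂F : ∀ p, ∀ x ∈ H₂.piece p (n - p), ι₂.baseChange ℂ x ∈ HU.piece p (n - p))
    (ψ₁ : H₁.Polarization) (ψ₂ : H₂.Polarization)
    (hE₂ : ∀ a ∈ H₂.endAlg, ∃ x : ℚ, a = x • 1) (hV₂ : Module.finrank ℚ V₂ = 2)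
    (hHom : ∀ f : V₂ →ₗ[ℚ] V₁,
      (∀ p, ∀ x ∈ H₂.piece p (n - p), f.baseChange ℂ x ∈ H₁.piece p (n - p)) → f = 0)
    (eQ : Module.Basis (Fin M) ℚ U) (q : (Fin d → Fin m × Fin M) → ℚ)
    {ΘU : Module.End ℂ (ℂ ⊗[ℚ] U)} (hΘU : ∀ p, ∀ x ∈ HU.piece p (n - p), ΘU x = ((2 * p - n : ℤ) : ℂ) • x)
    (hΘq : ∀ u : Fin d → Fin m, wordDerAt ℂ (fun _ : Fin d =>
      LinearMap.toMatrix (Algebra.TensorProduct.basis ℂ eQ) (Algebra.TensorProduct.basis ℂ eQ) ΘU)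
      (wordSlice (fun w => algebraMap ℚ ℂ (q w)) u) = 0)
    {Θ₁ : Module.End ℂ (ℂ ⊗[ℚ] V₁)} (hΘ₁ : ∀ p, ∀ x ∈ H₁.piece p (n - p), Θ₁ x = ((2 * p - n : ℤ) : ℂ) • x)
    (u : Fin d → Fin m) :
    wordDerAt ℂ (fun _ : Fin d =>
      LinearMap.toMatrix (Algebra.TensorProduct.basis ℂ eQ) (Algebra.TensorProduct.basis ℂ eQ)
        (ι₁.baseChange ℂ ∘ₗ Θ₁ ∘ₗ π₁.baseChange ℂ))
      (wordSlice (fun w => algebraMap ℚ ℂ (q w)) u) = 0 :=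
  wordDerAt_eq_zero_of_mem_spanC_annLie _ eQ _ q
    (incl₁_theta_proj_mem_spanC_annLie_of_times_nonCMCurve hn HU H₁ H₂ heff₁ heff₂ hπι₁ hπι₂ hπ₁ι₂ hπ₂ι₁ hsum hι₁F hι₂F ψ₁ ψ₂ hE₂ hV₂ hHom eQ q hΘU hΘq hΘ₁) u

end Main

end HodgeStructure

end Literature.AlgebraicGeometry.Motives

end
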